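import Literature.Computability.Complexity.HardcoreInapproximabilityCyclesJoint
import Literature.Computability.Complexity.HardcoreInapproximabilityTransfer
import Literature.Computability.AlgebraicComplexity.MignonRessayreBound
import HarnessLib

/-!
# Planting cycles in Sly's random bipartite core: exact counts (towards Lemma 3.8)

Allan Sly, *Computational transition at the uniqueness threshold*, FOCS 2010 (arXiv:1005.5584), §3.2
(Lemma 3.8, after MWW09 Lemmas 7.4–7.5: the quantities `P1`, `P2` and the configurations `Υ`).

The planted factorial moments `E[Y Π_i [X_i]_{m_i}]` of the small-subgraph-conditioning method are
sums, over families `F` of rooted cycles and slice configurations `(S, T)`, of the number of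
realisations `(σ, τ)` containing `F` in which `S ∪ E⁺ ∪ T ∪ E⁻` is independent. This file computes
these counts EXACTLY for vertex-disjoint families:

* `card_perm_prescribed_avoid`: permutations with `j` prescribed values and an avoidance constraint
  `π(A) ∩ B = ∅` number `(|α|-j-|B∖y|)^{(|A|)} (|α|-j-|A|)!` (the common generalisation of the
  counts behind `P1` and `P3`).
* `card_planted_indep_eq_prod`, `card_planted_indep`: colour by colour the event factorises, giving
  `#{ω ⊇ ⋃F : S ∪ E⁺ ∪ T ∪ E⁻ independent} = Π_c (N-e_c-|B∖y_c|)^{(|A_c|)}(N-e_c-|A_c|)! · (τ-factor)`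
  for feasible `(S,T)` (no planted edge with both ends occupied), and `0` otherwise; the cardinalities
  `|A_c| = a+|E⁺|-f⁺_c`, `|B∖y_c| = b+|E⁻|-f⁻_c` (`card_slyFamAσ`, `card_Bσ_sdiff`, …) are Sly's
  `f₊(k)`, `f₋(k)`.
* `sum_planted_slice`: summing over `|S| = a`, `|T| = b` groups the configurations by their traces
  `(χ⁺, χ⁻)` on the cycle slots — `C(n-J, a-|χ⁺|) C(n-J, b-|χ⁻|)` per trace pair
  (`card_powersetCard_filter_slyTrace`) — with the count `slyPlantedN` depending only on
  `(a, b, χ⁺, χ⁻)`.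
* `slyPlantedN_div`: normalised by `N_tot`, the count is `Π_c [C(N-e_c-b'+f⁻_c, a'-f⁺_c)/C(N-e_c, a'-f⁺_c)]/N^{(e_c)}`
  `· [C(n-e_τ-b+f⁻_τ, a-f⁺_τ)/C(n-e_τ, a-f⁺_τ)]/n^{(e_τ)}` — Sly's `P1 · P2` exactly.
* `sum_traceWeight_eq_prod_cycleSum`: the LIMIT trace weights `[feasible] c^J u^{|χ⁺|} v^{|χ⁻|}` factor over
  the cycles of the family into `Π_i (c^{i+1} CycleSum_{i+1}(u,v))^{m_i}` (with `HardcoreInapproximabilityTransfer`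
  this is `Π_i (1+δ)^{m_i}`).
* `card_presentU_indep_le_explicit`: for an ARBITRARY coloured edge set `U` (overlapping families) the
  planted-with-independence count is at most the product bound with all planted endpoints treated as
  occupied (`card_colour_prescribed_le`, monotonicity `descFactorial_mul_factorial_anti`).

No named facts. [cite: Sly2010, Lemma 3.8]
-/

namespace Literature.Computability.Complexity

open Finset

section PrescribedAvoid

/-- **Permutations with prescribed values and avoidance constraints.** For distinct points
`x₀,…,x_{j-1}`, distinct values `y₀,…,y_{j-1}`, and sets `A`, `B` with no `x_i ∈ A`, the number of
permutations `π` with `π x_i = y_i` for all `i` and `π(A) ∩ B = ∅` is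
`(|α| - j - |B ∖ {y_i}|)^{(|A|)} · (|α| - j - |A|)!` — generalising both
`card_perm_forall_apply_eq` (`A = ∅`) and `card_perm_filter_forall_not_mem` (`j = 0`); this is the
count behind Sly's `P1 · P2` (a planted cycle plus an independent set). [cite: Sly2010, Lemma 3.8 (proof, `P2`)] -/
theorem card_perm_prescribed_avoid (j : ℕ) :
    ∀ (α : Type*) [Fintype α] [DecidableEq α] (x y : Fin j → α),
      Function.Injective x → Function.Injective y → ∀ (A B : Finset α), (∀ i, x i ∉ A) →
      Fintype.card {π : Equiv.Perm α // (∀ i, π (x i) = y i) ∧ ∀ a ∈ A, π a ∉ B} =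
        (Fintype.card α - j - (B \ univ.image y).card).descFactorial A.card * (Fintype.card α - j - A.card).factorial := by
  induction j with
  | zero =>
      intro α _ _ x y _ _ A B _
      classical
      have e : {π : Equiv.Perm α // (∀ i, π (x i) = y i) ∧ ∀ a ∈ A, π a ∉ B} ≃ {π : Equiv.Perm α // ∀ a ∈ A, π a ∉ B} :=
        Equiv.subtypeEquivRight fun π => by simp
      rw [Fintype.card_congr e, Fintype.card_subtype, card_perm_filter_forall_not_mem A B, Nat.sub_zero]
      congr 2
      have : (univ : Finset (Fin 0)).image y = ∅ := by simp
      rw [this, Finset.sdiff_empty]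
  | succ j ih =>
      intro α _ _ x y hx hy A B hxA
      classical
      set s := Equiv.swap (y 0) (x 0) with hs
      have hxb : ∀ i : Fin j, x i.succ ≠ x 0 := fun i h => Fin.succ_ne_zero i (hx h)
      have hyb : ∀ i : Fin j, s (y i.succ) ≠ x 0 := by
        intro i h
        rw [hs, Equiv.swap_apply_eq_iff, Equiv.swap_apply_right] at h
        exact Fin.succ_ne_zero i (hy h)
      let x' : Fin j → {z // z ≠ x 0} := fun i => ⟨x i.succ, hxb i⟩
      let y' : Fin j → {z // z ≠ x 0} := fun i => ⟨s (y i.succ), hyb i⟩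
      have hx' : Function.Injective x' := fun i i' h =>
        Fin.succ_injective _ (hx (congrArg Subtype.val h :))
      have hy' : Function.Injective y' := fun i i' h =>
        Fin.succ_injective _ (hy (s.injective (congrArg Subtype.val h :)))
      -- the transported constraint sets on the subtype
      let A' : Finset {z // z ≠ x 0} := A.subtype fun z => z ≠ x 0
      let B' : Finset {z // z ≠ x 0} := (B.map s.toEmbedding).subtype fun z => z ≠ x 0
      have hxA' : ∀ i, x' i ∉ A' := fun i h => hxA i.succ (by simpa [A', Finset.mem_subtype] using h)
      -- Step 1: compose with the swap
      have e₁ : {π : Equiv.Perm α // (∀ i, π (x i) = y i) ∧ ∀ a ∈ A, π a ∉ B} ≃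
          {π : Equiv.Perm α // (π (x 0) = x 0 ∧ ∀ i : Fin j, π (x i.succ) = s (y i.succ)) ∧
            ∀ a ∈ A, π a ∉ B.map s.toEmbedding} :=
        Equiv.subtypeEquiv (Equiv.mulLeft s) fun π => by
          rw [Fin.forall_fin_succ]
          simp only [Equiv.coe_mulLeft, Equiv.Perm.mul_apply, Equiv.apply_eq_iff_eq]
          rw [hs, Equiv.swap_apply_eq_iff, Equiv.swap_apply_right]
          refine and_congr Iff.rfl (forall_congr' fun a => forall_congr' fun _ => ?_)
          rw [Finset.mem_map_equiv, Equiv.symm_swap, Equiv.swap_apply_self]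
      -- Step 2: permutations fixing `x 0` are permutations of the subtype
      have e₂ : {ρ : Equiv.Perm {z // z ≠ x 0} // (∀ i, ρ (x' i) = y' i) ∧ ∀ a ∈ A', ρ a ∉ B'} ≃
          {f : {f : Equiv.Perm α // ∀ z, ¬ z ≠ x 0 → f z = z} //
            (∀ i : Fin j, f.1 (x i.succ) = s (y i.succ)) ∧ ∀ a ∈ A, f.1 a ∉ B.map s.toEmbedding} :=
        Equiv.subtypeEquiv (Equiv.Perm.subtypeEquivSubtypePerm fun z => z ≠ x 0) fun ρ => by
          refine and_congr (forall_congr' fun i => ?_) ?_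
          · rw [Subtype.ext_iff, Equiv.Perm.subtypeEquivSubtypePerm_apply_of_mem ρ (hxb i)]
          · constructor
            · intro h a ha
              have ha0 : a ≠ x 0 := fun e => hxA 0 (e ▸ ha)
              have h1 := h ⟨a, ha0⟩ (by simpa [A', Finset.mem_subtype] using ha)
              rw [Equiv.Perm.subtypeEquivSubtypePerm_apply_of_mem ρ ha0]
              intro hmem
              exact h1 (by simpa [B', Finset.mem_subtype] using hmem)
            · intro h a ha
              obtain ⟨a, ha0⟩ := a
              have ha' : a ∈ A := by simpa [A', Finset.mem_subtype] using ha
              have h1 := h a ha'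
              rw [Equiv.Perm.subtypeEquivSubtypePerm_apply_of_mem ρ ha0] at h1
              intro hmem
              exact h1 (by simpa [B', Finset.mem_subtype] using hmem)
      have e₃ : {f : {f : Equiv.Perm α // ∀ z, ¬ z ≠ x 0 → f z = z} //
            (∀ i : Fin j, f.1 (x i.succ) = s (y i.succ)) ∧ ∀ a ∈ A, f.1 a ∉ B.map s.toEmbedding} ≃
          {f : Equiv.Perm α // (∀ z, ¬ z ≠ x 0 → f z = z) ∧
            ((∀ i : Fin j, f (x i.succ) = s (y i.succ)) ∧ ∀ a ∈ A, f a ∉ B.map s.toEmbedding)} :=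
        Equiv.subtypeSubtypeEquivSubtypeInter (fun f : Equiv.Perm α => ∀ z, ¬ z ≠ x 0 → f z = z)
          (fun f : Equiv.Perm α => (∀ i : Fin j, f (x i.succ) = s (y i.succ)) ∧ ∀ a ∈ A, f a ∉ B.map s.toEmbedding)
      have e₄ : {f : Equiv.Perm α // (∀ z, ¬ z ≠ x 0 → f z = z) ∧
            ((∀ i : Fin j, f (x i.succ) = s (y i.succ)) ∧ ∀ a ∈ A, f a ∉ B.map s.toEmbedding)} ≃
          {π : Equiv.Perm α // (π (x 0) = x 0 ∧ ∀ i : Fin j, π (x i.succ) = s (y i.succ)) ∧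
            ∀ a ∈ A, π a ∉ B.map s.toEmbedding} :=
        Equiv.subtypeEquivRight fun π => by simp only [ne_eq, not_not, forall_eq, and_assoc]
      rw [Fintype.card_congr e₁, ← Fintype.card_congr ((e₂.trans e₃).trans e₄), ih _ x' y' hx' hy' A' B' hxA',
        Fintype.card_subtype_compl, Fintype.card_subtype_eq]
      -- the bookkeeping of the cardinalities
      have hA' : A'.card = A.card := by
        simp only [A', Finset.card_subtype]
        rw [Finset.filter_true_of_mem]
        intro a ha e
        exact hxA 0 (e ▸ ha)
      have hB' : (B' \ univ.image y').card = (B \ univ.image y).card := by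
        -- `b ↦ ⟨s b, _⟩` is a bijection from `B \ range y` onto `B' \ range y'`
        refine (Finset.card_bij' (fun (b' : {z // z ≠ x 0}) _ => s b'.1) (fun b hb => ⟨s b, ?_⟩) ?_ ?_ ?_ ?_).symm.symm
        · -- `s b ≠ x 0` since `b ≠ y 0`
          intro h
          rw [hs, Equiv.swap_apply_eq_iff, Equiv.swap_apply_right] at h
          rw [Finset.mem_sdiff] at hb
          exact hb.2 (h ▸ Finset.mem_image_of_mem y (Finset.mem_univ 0))
        · intro b' hb'
          rw [Finset.mem_sdiff] at hb' ⊢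
          obtain ⟨h1, h2⟩ := hb'
          have h1' : (b' : α) ∈ B.map s.toEmbedding := by simpa [B', Finset.mem_subtype] using h1
          rw [Finset.mem_map_equiv, Equiv.symm_swap] at h1'
          refine ⟨by rw [hs]; exact h1', fun hmem => h2 ?_⟩
          rw [Finset.mem_image] at hmem ⊢
          obtain ⟨i, -, hi⟩ := hmem
          refine Fin.cases ?_ (fun i hi => ⟨i, Finset.mem_univ _, Subtype.ext ?_⟩) i hi
          · intro hi
            exfalso; apply b'.2
            apply s.injective
            rw [← hi, hs, Equiv.swap_apply_right]
          · show s (y i.succ) = b'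
            rw [hi, hs, Equiv.swap_apply_self]
        · intro b hb
          rw [Finset.mem_sdiff] at hb ⊢
          refine ⟨by simpa [B', Finset.mem_subtype, Finset.mem_map_equiv, Equiv.symm_swap, hs, Equiv.swap_apply_self] using hb.1,
            fun hmem => hb.2 ?_⟩
          rw [Finset.mem_image] at hmem ⊢
          obtain ⟨i, -, hi⟩ := hmem
          exact ⟨i.succ, Finset.mem_univ _, s.injective (congrArg Subtype.val hi :)⟩
        · intro b' _; exact Subtype.ext (by simp [hs, Equiv.swap_apply_self])
        · intro b _; simp [hs, Equiv.swap_apply_self]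
      rw [hA', hB']
      have e1 : Fintype.card α - 1 - j - (B \ univ.image y).card = Fintype.card α - (j + 1) - (B \ univ.image y).card := by omega
      have e2 : Fintype.card α - 1 - j - A.card = Fintype.card α - (j + 1) - A.card := by omega
      rw [e1, e2]

end PrescribedAvoid

section PrescribedAvoidGeneral

/-- `card_perm_prescribed_avoid` with an arbitrary finite index type for the prescribed pairs. [folklore] -/
theorem card_perm_prescribed_avoid' {ι α : Type*} [Fintype ι] [Fintype α] [DecidableEq α] (x y : ι → α)
    (hx : Function.Injective x) (hy : Function.Injective y) (A B : Finset α) (hA : ∀ i, x i ∉ A) :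
    Fintype.card {π : Equiv.Perm α // (∀ i, π (x i) = y i) ∧ ∀ a ∈ A, π a ∉ B} =
      (Fintype.card α - Fintype.card ι - (B \ univ.image y).card).descFactorial A.card *
        (Fintype.card α - Fintype.card ι - A.card).factorial := by
  classical
  set e := Fintype.equivFin ι
  have h := card_perm_prescribed_avoid (Fintype.card ι) α (x ∘ e.symm) (y ∘ e.symm)
    (hx.comp e.symm.injective) (hy.comp e.symm.injective) A B (fun i => hA _)
  have himg : (univ : Finset (Fin (Fintype.card ι))).image (y ∘ e.symm) = univ.image y := by
    ext b
    simp only [Finset.mem_image, Finset.mem_univ, true_and, Function.comp]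
    constructor
    · rintro ⟨i, rfl⟩; exact ⟨_, rfl⟩
    · rintro ⟨i, rfl⟩; exact ⟨e i, by simp⟩
  rw [himg] at h
  rw [← h]
  refine Fintype.card_congr (Equiv.subtypeEquivRight fun π => and_congr ?_ Iff.rfl)
  constructor
  · intro h' i; exact h' (e.symm i)
  · intro h' i; simpa [e] using h' (e i)

end PrescribedAvoidGeneral

section PlantedColour

variable {n m' q k : ℕ} {mv : Fin k → ℕ}

/-- The planted edges of colour `c` of a family, as a subtype of the edge slots. [folklore] -/
abbrev SlyFamEdgesOf (F : (i : Fin k) → Fin (mv i) → SlyWCycle n q ((i : ℕ) + 1)) (c : Option (Fin q)) : Type :=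
  {p : Σ i : Fin k, Fin (mv i) × (Fin ((i : ℕ) + 1) ⊕ Fin ((i : ℕ) + 1)) // (F p.1 p.2.1).colour p.2.2 = c}

/-- Plus endpoints of the planted edges of a colour (in `W = Fin n`). [folklore] -/
def slyFamPE (F : (i : Fin k) → Fin (mv i) → SlyWCycle n q ((i : ℕ) + 1)) (c : Option (Fin q)) (p : SlyFamEdgesOf F c) : Fin n :=
  (F p.1.1 p.1.2.1).plusEnd p.1.2.2

/-- Minus endpoints of the planted edges of a colour. [folklore] -/
def slyFamME (F : (i : Fin k) → Fin (mv i) → SlyWCycle n q ((i : ℕ) + 1)) (c : Option (Fin q)) (p : SlyFamEdgesOf F c) : Fin n :=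
  (F p.1.1 p.1.2.1).minusEnd p.1.2.2

/-- For a vertex-disjoint family the plus endpoints within a colour class are distinct. [folklore] -/
theorem slyFamPE_injective {F : (i : Fin k) → Fin (mv i) → SlyWCycle n q ((i : ℕ) + 1)} (hF : SlyFamDisjoint F) (c : Option (Fin q)) :
    Function.Injective (slyFamPE F c) := by
  rintro ⟨⟨i, a, e⟩, he⟩ ⟨⟨i', a', e'⟩, he'⟩ h
  simp only [slyFamPE, SlyWCycle.plusEnd_eq] at h
  have hk := hF.1 (a₁ := ⟨i, a, slyPlusIdx _ e⟩) (a₂ := ⟨i', a', slyPlusIdx _ e'⟩) h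
  simp only [Sigma.mk.injEq] at hk
  obtain ⟨rfl, hk2⟩ := hk
  simp only [heq_eq_eq, Prod.mk.injEq] at hk2
  obtain ⟨rfl, -⟩ := hk2
  simp only at he he'
  have hee : e = e' := (F i a).injOn_plusEnd c (x₁ := e) (x₂ := e')
    (Finset.mem_coe.2 (Finset.mem_filter.2 ⟨Finset.mem_univ _, he⟩))
    (Finset.mem_coe.2 (Finset.mem_filter.2 ⟨Finset.mem_univ _, he'⟩)) (by simpa [SlyWCycle.plusEnd_eq] using h)
  subst hee
  rfl

/-- For a vertex-disjoint family the minus endpoints within a colour class are distinct. [folklore] -/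
theorem slyFamME_injective {F : (i : Fin k) → Fin (mv i) → SlyWCycle n q ((i : ℕ) + 1)} (hF : SlyFamDisjoint F) (c : Option (Fin q)) :
    Function.Injective (slyFamME F c) := by
  rintro ⟨⟨i, a, e⟩, he⟩ ⟨⟨i', a', e'⟩, he'⟩ h
  simp only [slyFamME, SlyWCycle.minusEnd_eq] at h
  have hk := hF.2 (a₁ := ⟨i, a, slyMinusIdx _ e⟩) (a₂ := ⟨i', a', slyMinusIdx _ e'⟩) h
  simp only [Sigma.mk.injEq] at hk
  obtain ⟨rfl, hk2⟩ := hk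
  simp only [heq_eq_eq, Prod.mk.injEq] at hk2
  obtain ⟨rfl, -⟩ := hk2
  simp only at he he'
  have hee : e = e' := (F i a).injOn_minusEnd c (x₁ := e) (x₂ := e')
    (Finset.mem_coe.2 (Finset.mem_filter.2 ⟨Finset.mem_univ _, he⟩))
    (Finset.mem_coe.2 (Finset.mem_filter.2 ⟨Finset.mem_univ _, he'⟩)) (by simpa [SlyWCycle.minusEnd_eq] using h)
  subst hee
  rfl

end PlantedColour

section PlantedFactorisation

variable {n m' q k : ℕ} {mv : Fin k → ℕ}

/-- **Feasibility** of a slice configuration `(S, T)` against a planted family: no planted edge has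
both endpoints occupied (otherwise no realisation contains the family with `S ∪ T` independent). [folklore] -/
def SlyFamFeasible (F : (i : Fin k) → Fin (mv i) → SlyWCycle n q ((i : ℕ) + 1)) (S T : Finset (Fin n)) : Prop :=
  ∀ i a e, ¬((F i a).plusEnd e ∈ S ∧ (F i a).minusEnd e ∈ T)

/-- The free occupied plus vertices for colour `c`: occupied `W⁺ ∪ U⁺` vertices minus the plus
endpoints of the planted colour-`c` edges. [folklore] -/
noncomputable def slyFamAσ (F : (i : Fin k) → Fin (mv i) → SlyWCycle n q ((i : ℕ) + 1)) (S : Finset (Fin n)) (Ep : Finset (Fin m'))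
    (c : Fin q) : Finset (Fin (n + m')) :=
  (S.map (Fin.castAddEmb m') ∪ Ep.map (Fin.natAddEmb n)) \ univ.image (fun p : SlyFamEdgesOf F (some c) => Fin.castAdd m' (slyFamPE F (some c) p))

/-- The free occupied plus vertices for the `W`-matching `τ`. [folklore] -/
noncomputable def slyFamAτ (F : (i : Fin k) → Fin (mv i) → SlyWCycle n q ((i : ℕ) + 1)) (S : Finset (Fin n)) : Finset (Fin n) :=
  S \ univ.image (slyFamPE F none)

open scoped Classical in
/-- **Planting a family factorises over the matchings**: the realisations containing a vertex-disjoint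
family `F` in which `S ∪ E⁺ ∪ T ∪ E⁻` is independent are, colour by colour, the permutations with the
planted colour-`c` edges prescribed that map no free occupied plus vertex to an occupied minus vertex
(for feasible `(S,T)`). [cite: Sly2010, Lemma 3.8 (proof: `P1 · P2`)] -/
theorem card_planted_indep_eq_prod (F : (i : Fin k) → Fin (mv i) → SlyWCycle n q ((i : ℕ) + 1))
    (S T : Finset (Fin n)) (Ep Em : Finset (Fin m')) (hfeas : SlyFamFeasible F S T) :
    Fintype.card {ω : (Fin q → Equiv.Perm (Fin (n + m'))) × Equiv.Perm (Fin n) //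
        (∀ i a, (F i a).Present ω.1 ω.2) ∧ SlyCoreIndep ω.1 ω.2 S T Ep Em} =
      (∏ c : Fin q, Fintype.card {π : Equiv.Perm (Fin (n + m')) //
          (∀ p : SlyFamEdgesOf F (some c), π (Fin.castAdd m' (slyFamPE F (some c) p)) = Fin.castAdd m' (slyFamME F (some c) p)) ∧
            ∀ v ∈ slyFamAσ F S Ep c, π v ∉ T.map (Fin.castAddEmb m') ∪ Em.map (Fin.natAddEmb n)}) *
        Fintype.card {τ : Equiv.Perm (Fin n) //
          (∀ p : SlyFamEdgesOf F none, τ (slyFamPE F none p) = slyFamME F none p) ∧ ∀ v ∈ slyFamAτ F S, τ v ∉ T} := by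
  -- pointwise description of the event
  have hpt : ∀ ω : (Fin q → Equiv.Perm (Fin (n + m'))) × Equiv.Perm (Fin n),
      ((∀ i a, (F i a).Present ω.1 ω.2) ∧ SlyCoreIndep ω.1 ω.2 S T Ep Em) ↔
        (∀ c : Fin q, (∀ p : SlyFamEdgesOf F (some c), ω.1 c (Fin.castAdd m' (slyFamPE F (some c) p)) = Fin.castAdd m' (slyFamME F (some c) p)) ∧
            ∀ v ∈ slyFamAσ F S Ep c, ω.1 c v ∉ T.map (Fin.castAddEmb m') ∪ Em.map (Fin.natAddEmb n)) ∧
          ((∀ p : SlyFamEdgesOf F none, ω.2 (slyFamPE F none p) = slyFamME F none p) ∧ ∀ v ∈ slyFamAτ F S, ω.2 v ∉ T) := by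
    rintro ⟨σ, τ⟩
    have hpresent : (∀ i a, (F i a).Present σ τ) ↔
        (∀ c : Fin q, ∀ p : SlyFamEdgesOf F (some c), σ c (Fin.castAdd m' (slyFamPE F (some c) p)) = Fin.castAdd m' (slyFamME F (some c) p)) ∧
          ∀ p : SlyFamEdgesOf F none, τ (slyFamPE F none p) = slyFamME F none p := by
      constructor
      · intro h
        refine ⟨fun c p => ?_, fun p => ?_⟩
        · obtain ⟨⟨i, a, e⟩, he⟩ := p
          exact ((F i a).present_iff σ τ).1 (h i a) |>.1 c e (Finset.mem_filter.2 ⟨Finset.mem_univ _, he⟩)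
        · obtain ⟨⟨i, a, e⟩, he⟩ := p
          exact ((F i a).present_iff σ τ).1 (h i a) |>.2 e (Finset.mem_filter.2 ⟨Finset.mem_univ _, he⟩)
      · rintro ⟨h1, h2⟩ i a
        refine ((F i a).present_iff σ τ).2 ⟨fun c e he => h1 c ⟨⟨i, a, e⟩, (Finset.mem_filter.1 he).2⟩,
          fun e he => h2 ⟨⟨i, a, e⟩, (Finset.mem_filter.1 he).2⟩⟩
    simp only
    constructor
    · rintro ⟨hpres, hind1, hind2⟩
      obtain ⟨h1, h2⟩ := hpresent.1 hpres
      refine ⟨fun c => ⟨h1 c, fun v hv => hind1 c v (Finset.mem_sdiff.1 hv).1⟩, h2, fun v hv => hind2 v (Finset.mem_sdiff.1 hv).1⟩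
    · rintro ⟨hσ, hτ1, hτ2⟩
      have hpres : ∀ i a, (F i a).Present σ τ := hpresent.2 ⟨fun c => (hσ c).1, hτ1⟩
      refine ⟨hpres, fun c v hv => ?_, fun v hv => ?_⟩
      · by_cases hvx : v ∈ univ.image (fun p : SlyFamEdgesOf F (some c) => Fin.castAdd m' (slyFamPE F (some c) p))
        · -- a planted plus endpoint: its image is the (unoccupied) minus endpoint
          obtain ⟨p, -, rfl⟩ := Finset.mem_image.1 hvx
          rw [(hσ c).1 p]
          obtain ⟨⟨i, a, e⟩, he⟩ := p
          -- the plus endpoint is an occupied `W`-vertex, so by feasibility the minus endpoint is free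
          have hplus : slyFamPE F (some c) ⟨⟨i, a, e⟩, he⟩ ∈ S := by
            rcases Finset.mem_union.1 hv with hS | hE
            · obtain ⟨s', hs', hse⟩ := Finset.mem_map.1 hS
              have : s' = slyFamPE F (some c) ⟨⟨i, a, e⟩, he⟩ := Fin.castAdd_injective n m' (by simpa using hse)
              subst this
              exact hs'
            · obtain ⟨u, -, hu⟩ := Finset.mem_map.1 hE
              exfalso
              have h1 : n ≤ ((Fin.natAddEmb n u : Fin (n + m')) : ℕ) := by simp
              rw [hu] at h1
              exact absurd h1 (not_le.2 (by simp))
          intro hmem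
          rcases Finset.mem_union.1 hmem with hT | hE
          · obtain ⟨t', ht', hte⟩ := Finset.mem_map.1 hT
            have : t' = slyFamME F (some c) ⟨⟨i, a, e⟩, he⟩ := Fin.castAdd_injective n m' (by simpa using hte)
            subst this
            exact hfeas i a e ⟨hplus, ht'⟩
          · obtain ⟨u, -, hu⟩ := Finset.mem_map.1 hE
            have h1 : n ≤ ((Fin.natAddEmb n u : Fin (n + m')) : ℕ) := by simp
            rw [hu] at h1
            exact absurd h1 (not_le.2 (by simp))
        · exact (hσ c).2 v (Finset.mem_sdiff.2 ⟨hv, hvx⟩)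
      · by_cases hvx : v ∈ univ.image (slyFamPE F none)
        · obtain ⟨p, -, rfl⟩ := Finset.mem_image.1 hvx
          rw [hτ1 p]
          obtain ⟨⟨i, a, e⟩, he⟩ := p
          intro hmem
          exact hfeas i a e ⟨hv, hmem⟩
        · exact hτ2 v (Finset.mem_sdiff.2 ⟨hv, hvx⟩)
  -- factorise the count: the event is a product event
  rw [Fintype.card_subtype, Finset.filter_congr (fun ω _ => hpt ω)]
  have hprod : (univ.filter fun ω : (Fin q → Equiv.Perm (Fin (n + m'))) × Equiv.Perm (Fin n) =>
      (∀ c : Fin q, (∀ p : SlyFamEdgesOf F (some c), ω.1 c (Fin.castAdd m' (slyFamPE F (some c) p)) = Fin.castAdd m' (slyFamME F (some c) p)) ∧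
          ∀ v ∈ slyFamAσ F S Ep c, ω.1 c v ∉ T.map (Fin.castAddEmb m') ∪ Em.map (Fin.natAddEmb n)) ∧
        ((∀ p : SlyFamEdgesOf F none, ω.2 (slyFamPE F none p) = slyFamME F none p) ∧ ∀ v ∈ slyFamAτ F S, ω.2 v ∉ T)) =
      (univ.filter fun σ : Fin q → Equiv.Perm (Fin (n + m')) => ∀ c : Fin q,
        (∀ p : SlyFamEdgesOf F (some c), σ c (Fin.castAdd m' (slyFamPE F (some c) p)) = Fin.castAdd m' (slyFamME F (some c) p)) ∧
          ∀ v ∈ slyFamAσ F S Ep c, σ c v ∉ T.map (Fin.castAddEmb m') ∪ Em.map (Fin.natAddEmb n)) ×ˢ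
      (univ.filter fun τ : Equiv.Perm (Fin n) =>
        (∀ p : SlyFamEdgesOf F none, τ (slyFamPE F none p) = slyFamME F none p) ∧ ∀ v ∈ slyFamAτ F S, τ v ∉ T) := by
    ext ω
    simp only [Finset.mem_filter, Finset.mem_product, Finset.mem_univ, true_and]
  rw [hprod, Finset.card_product, Fintype.card_subtype]
  congr 1
  -- the `σ`-part is a product over the colours
  have hpi : (univ.filter fun σ : Fin q → Equiv.Perm (Fin (n + m')) => ∀ c : Fin q,
      (∀ p : SlyFamEdgesOf F (some c), σ c (Fin.castAdd m' (slyFamPE F (some c) p)) = Fin.castAdd m' (slyFamME F (some c) p)) ∧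
        ∀ v ∈ slyFamAσ F S Ep c, σ c v ∉ T.map (Fin.castAddEmb m') ∪ Em.map (Fin.natAddEmb n)) =
      Fintype.piFinset fun c : Fin q => univ.filter fun π : Equiv.Perm (Fin (n + m')) =>
        (∀ p : SlyFamEdgesOf F (some c), π (Fin.castAdd m' (slyFamPE F (some c) p)) = Fin.castAdd m' (slyFamME F (some c) p)) ∧
          ∀ v ∈ slyFamAσ F S Ep c, π v ∉ T.map (Fin.castAddEmb m') ∪ Em.map (Fin.natAddEmb n) := by
    ext σ
    simp only [Finset.mem_filter, Finset.mem_univ, true_and, Fintype.mem_piFinset]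
  rw [hpi, Fintype.card_piFinset]
  refine Finset.prod_congr rfl fun c _ => ?_
  rw [Fintype.card_subtype]

end PlantedFactorisation

section PlantedCount

variable {n m' q k : ℕ} {mv : Fin k → ℕ}

open scoped Classical in
/-- **The exact planted count** (Sly's `P1 · P2` as a number of realisations): for a vertex-disjoint
family `F` and a feasible slice configuration `(S, T)` with boundary `(E⁺, E⁻)`,
`#{ω ⊇ ⋃F : S ∪ E⁺ ∪ T ∪ E⁻ independent} = Π_c (N - e_c - |B ∖ y_c|)^{(|A_c|)} (N - e_c - |A_c|)! ·
(n - e_τ - |T ∖ y_τ|)^{(|A_τ|)} (n - e_τ - |A_τ|)!`, with `N = n + m'`, `e_c` the number of planted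
edges of colour `c`, `A_c` the free occupied plus vertices and `B ∖ y_c` the occupied minus vertices
that are not planted colour-`c` targets. [cite: Sly2010, Lemma 3.8 (proof: `P2`, eq. (e:P2expression))] -/
theorem card_planted_indep {F : (i : Fin k) → Fin (mv i) → SlyWCycle n q ((i : ℕ) + 1)} (hF : SlyFamDisjoint F)
    (S T : Finset (Fin n)) (Ep Em : Finset (Fin m')) (hfeas : SlyFamFeasible F S T) :
    Fintype.card {ω : (Fin q → Equiv.Perm (Fin (n + m'))) × Equiv.Perm (Fin n) //
        (∀ i a, (F i a).Present ω.1 ω.2) ∧ SlyCoreIndep ω.1 ω.2 S T Ep Em} =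
      (∏ c : Fin q,
        ((n + m' - Fintype.card (SlyFamEdgesOf F (some c)) -
            ((T.map (Fin.castAddEmb m') ∪ Em.map (Fin.natAddEmb n)) \
              univ.image (fun p : SlyFamEdgesOf F (some c) => Fin.castAdd m' (slyFamME F (some c) p))).card).descFactorial
            (slyFamAσ F S Ep c).card *
          (n + m' - Fintype.card (SlyFamEdgesOf F (some c)) - (slyFamAσ F S Ep c).card).factorial)) *
      ((n - Fintype.card (SlyFamEdgesOf F none) - (T \ univ.image (slyFamME F none)).card).descFactorial (slyFamAτ F S).card *
        (n - Fintype.card (SlyFamEdgesOf F none) - (slyFamAτ F S).card).factorial) := by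
  rw [card_planted_indep_eq_prod F S T Ep Em hfeas]
  congr 1
  · refine Finset.prod_congr rfl fun c _ => ?_
    have h := card_perm_prescribed_avoid' (fun p : SlyFamEdgesOf F (some c) => Fin.castAdd m' (slyFamPE F (some c) p))
      (fun p : SlyFamEdgesOf F (some c) => Fin.castAdd m' (slyFamME F (some c) p))
      ((Fin.castAdd_injective n m').comp (slyFamPE_injective hF _)) ((Fin.castAdd_injective n m').comp (slyFamME_injective hF _))
      (slyFamAσ F S Ep c) (T.map (Fin.castAddEmb m') ∪ Em.map (Fin.natAddEmb n))
      (fun p h => by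
        unfold slyFamAσ at h
        exact (Finset.mem_sdiff.1 h).2 (Finset.mem_image.2 ⟨p, Finset.mem_univ _, rfl⟩))
    rw [Fintype.card_fin] at h
    convert h using 2
  · have h := card_perm_prescribed_avoid' (slyFamPE F none) (slyFamME F none) (slyFamPE_injective hF _) (slyFamME_injective hF _)
      (slyFamAτ F S) T
      (fun p h => by
        unfold slyFamAτ at h
        exact (Finset.mem_sdiff.1 h).2 (Finset.mem_image.2 ⟨p, Finset.mem_univ _, rfl⟩))
    rw [Fintype.card_fin] at h
    convert h using 2

open scoped Classical in
/-- If the slice configuration is infeasible for the family, no realisation qualifies. [folklore] -/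
theorem card_planted_indep_eq_zero {F : (i : Fin k) → Fin (mv i) → SlyWCycle n q ((i : ℕ) + 1)}
    (S T : Finset (Fin n)) (Ep Em : Finset (Fin m')) (hfeas : ¬SlyFamFeasible F S T) :
    Fintype.card {ω : (Fin q → Equiv.Perm (Fin (n + m'))) × Equiv.Perm (Fin n) //
        (∀ i a, (F i a).Present ω.1 ω.2) ∧ SlyCoreIndep ω.1 ω.2 S T Ep Em} = 0 := by
  rw [Fintype.card_eq_zero_iff]
  refine ⟨fun ⟨⟨σ, τ⟩, hpres, hind⟩ => hfeas fun i a e ⟨hS, hT⟩ => ?_⟩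
  obtain ⟨h1, h2⟩ := ((F i a).present_iff σ τ).1 (hpres i a)
  cases hc : (F i a).colour e with
  | none =>
    have := h2 e (Finset.mem_filter.2 ⟨Finset.mem_univ _, hc⟩)
    exact hind.2 _ hS (this ▸ hT)
  | some c =>
    have := h1 c e (Finset.mem_filter.2 ⟨Finset.mem_univ _, hc⟩)
    refine hind.1 c (Fin.castAdd m' ((F i a).plusEnd e)) (Finset.mem_union_left _ ?_) ?_
    · exact Finset.mem_map.2 ⟨_, hS, rfl⟩
    · rw [this]; exact Finset.mem_union_left _ (Finset.mem_map.2 ⟨_, hT, rfl⟩)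

end PlantedCount

section PlantedCardinalities

variable {n m' q k : ℕ} {mv : Fin k → ℕ}

/-- `|A_c| = |S| + |E⁺| - f⁺_c`: the free occupied plus vertices are all occupied plus vertices but the
`f⁺_c` occupied plus endpoints of planted colour-`c` edges. [cite: Sly2010, Lemma 3.8 (proof: `f₊(k)`)] -/
theorem card_slyFamAσ {F : (i : Fin k) → Fin (mv i) → SlyWCycle n q ((i : ℕ) + 1)} (hF : SlyFamDisjoint F)
    (S : Finset (Fin n)) (Ep : Finset (Fin m')) (c : Fin q) :
    (slyFamAσ F S Ep c).card + (univ.filter fun p : SlyFamEdgesOf F (some c) => slyFamPE F (some c) p ∈ S).card = S.card + Ep.card := by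
  classical
  unfold slyFamAσ
  set X := univ.image (fun p : SlyFamEdgesOf F (some c) => Fin.castAdd m' (slyFamPE F (some c) p)) with hX
  set P := S.map (Fin.castAddEmb m') ∪ Ep.map (Fin.natAddEmb n) with hP
  have h1 : (P \ X).card + (P ∩ X).card = P.card := Finset.card_sdiff_add_card_inter P X
  have h2 : (P ∩ X).card = (univ.filter fun p : SlyFamEdgesOf F (some c) => slyFamPE F (some c) p ∈ S).card := by
    -- `P ∩ X` is the image of the filtered edges under the injective map
    rw [← Finset.card_image_of_injective (univ.filter fun p : SlyFamEdgesOf F (some c) => slyFamPE F (some c) p ∈ S)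
      ((Fin.castAdd_injective n m').comp (slyFamPE_injective hF (some c)))]
    congr 1
    ext v
    simp only [Finset.mem_inter, hX, Finset.mem_image, Finset.mem_univ, true_and, Finset.mem_filter, Function.comp]
    constructor
    · rintro ⟨hvP, p, rfl⟩
      refine ⟨p, ?_, rfl⟩
      rw [hP, Finset.mem_union] at hvP
      rcases hvP with hS | hE
      · obtain ⟨s', hs', hse⟩ := Finset.mem_map.1 hS
        have : s' = slyFamPE F (some c) p := Fin.castAdd_injective n m' (by simpa using hse)
        exact this ▸ hs'
      · obtain ⟨u, -, hu⟩ := Finset.mem_map.1 hE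
        exfalso
        have h1 : n ≤ ((Fin.natAddEmb n u : Fin (n + m')) : ℕ) := by simp
        rw [hu] at h1
        exact absurd h1 (not_le.2 (by simp))
    · rintro ⟨p, hp, rfl⟩
      exact ⟨by rw [hP]; exact Finset.mem_union_left _ (Finset.mem_map.2 ⟨_, hp, rfl⟩), p, rfl⟩
  have h3 : P.card = S.card + Ep.card := by rw [hP]; exact card_map_castAddEmb_union_map_natAddEmb S Ep
  omega

/-- `|B ∖ y_c| = |T| + |E⁻| - f⁻_c`. [cite: Sly2010, Lemma 3.8 (proof: `f₋(k)`)] -/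
theorem card_Bσ_sdiff {F : (i : Fin k) → Fin (mv i) → SlyWCycle n q ((i : ℕ) + 1)} (hF : SlyFamDisjoint F)
    (T : Finset (Fin n)) (Em : Finset (Fin m')) (c : Fin q) :
    ((T.map (Fin.castAddEmb m') ∪ Em.map (Fin.natAddEmb n)) \
        univ.image (fun p : SlyFamEdgesOf F (some c) => Fin.castAdd m' (slyFamME F (some c) p))).card +
      (univ.filter fun p : SlyFamEdgesOf F (some c) => slyFamME F (some c) p ∈ T).card = T.card + Em.card := by
  classical
  set X := univ.image (fun p : SlyFamEdgesOf F (some c) => Fin.castAdd m' (slyFamME F (some c) p)) with hX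
  set P := T.map (Fin.castAddEmb m') ∪ Em.map (Fin.natAddEmb n) with hP
  have h1 : (P \ X).card + (P ∩ X).card = P.card := Finset.card_sdiff_add_card_inter P X
  have h2 : (P ∩ X).card = (univ.filter fun p : SlyFamEdgesOf F (some c) => slyFamME F (some c) p ∈ T).card := by
    rw [← Finset.card_image_of_injective (univ.filter fun p : SlyFamEdgesOf F (some c) => slyFamME F (some c) p ∈ T)
      ((Fin.castAdd_injective n m').comp (slyFamME_injective hF (some c)))]
    congr 1
    ext v
    simp only [Finset.mem_inter, hX, Finset.mem_image, Finset.mem_univ, true_and, Finset.mem_filter, Function.comp]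
    constructor
    · rintro ⟨hvP, p, rfl⟩
      refine ⟨p, ?_, rfl⟩
      rw [hP, Finset.mem_union] at hvP
      rcases hvP with hT | hE
      · obtain ⟨t', ht', hte⟩ := Finset.mem_map.1 hT
        have : t' = slyFamME F (some c) p := Fin.castAdd_injective n m' (by simpa using hte)
        exact this ▸ ht'
      · obtain ⟨u, -, hu⟩ := Finset.mem_map.1 hE
        exfalso
        have h1 : n ≤ ((Fin.natAddEmb n u : Fin (n + m')) : ℕ) := by simp
        rw [hu] at h1
        exact absurd h1 (not_le.2 (by simp))
    · rintro ⟨p, hp, rfl⟩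
      exact ⟨by rw [hP]; exact Finset.mem_union_left _ (Finset.mem_map.2 ⟨_, hp, rfl⟩), p, rfl⟩
  have h3 : P.card = T.card + Em.card := by rw [hP]; exact card_map_castAddEmb_union_map_natAddEmb T Em
  omega

/-- `|A_τ| = |S| - f⁺_τ`. [folklore] -/
theorem card_slyFamAτ {F : (i : Fin k) → Fin (mv i) → SlyWCycle n q ((i : ℕ) + 1)} (hF : SlyFamDisjoint F) (S : Finset (Fin n)) :
    (slyFamAτ F S).card + (univ.filter fun p : SlyFamEdgesOf F none => slyFamPE F none p ∈ S).card = S.card := by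
  classical
  unfold slyFamAτ
  have h1 := Finset.card_sdiff_add_card_inter S (univ.image (slyFamPE F none))
  have h2 : (S ∩ univ.image (slyFamPE F none)).card = (univ.filter fun p : SlyFamEdgesOf F none => slyFamPE F none p ∈ S).card := by
    rw [← Finset.card_image_of_injective (univ.filter fun p : SlyFamEdgesOf F none => slyFamPE F none p ∈ S)
      (slyFamPE_injective hF none)]
    congr 1
    ext v
    simp only [Finset.mem_inter, Finset.mem_image, Finset.mem_univ, true_and, Finset.mem_filter]
    constructor
    · rintro ⟨hv, p, rfl⟩; exact ⟨p, hv, rfl⟩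
    · rintro ⟨p, hp, rfl⟩; exact ⟨hp, p, rfl⟩
  omega

/-- `|T ∖ y_τ| = |T| - f⁻_τ`. [folklore] -/
theorem card_T_sdiff {F : (i : Fin k) → Fin (mv i) → SlyWCycle n q ((i : ℕ) + 1)} (hF : SlyFamDisjoint F) (T : Finset (Fin n)) :
    (T \ univ.image (slyFamME F none)).card + (univ.filter fun p : SlyFamEdgesOf F none => slyFamME F none p ∈ T).card = T.card := by
  classical
  have h1 := Finset.card_sdiff_add_card_inter T (univ.image (slyFamME F none))
  have h2 : (T ∩ univ.image (slyFamME F none)).card = (univ.filter fun p : SlyFamEdgesOf F none => slyFamME F none p ∈ T).card := by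
    rw [← Finset.card_image_of_injective (univ.filter fun p : SlyFamEdgesOf F none => slyFamME F none p ∈ T)
      (slyFamME_injective hF none)]
    congr 1
    ext v
    simp only [Finset.mem_inter, Finset.mem_image, Finset.mem_univ, true_and, Finset.mem_filter]
    constructor
    · rintro ⟨hv, p, rfl⟩; exact ⟨p, hv, rfl⟩
    · rintro ⟨p, hp, rfl⟩; exact ⟨hp, p, rfl⟩
  omega

end PlantedCardinalities

section Traces

variable {n : ℕ} {SL : Type*} [Fintype SL] [DecidableEq SL]

/-- The **trace** of a vertex set on an injectively embedded slot set. [folklore] -/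
def slyTrace (V : SL ↪ Fin n) (S : Finset (Fin n)) : Finset SL := univ.filter fun s => V s ∈ S

omit [DecidableEq SL] in
/-- Membership in the trace. [folklore] -/
theorem mem_slyTrace {V : SL ↪ Fin n} {S : Finset (Fin n)} {s : SL} : s ∈ slyTrace V S ↔ V s ∈ S := by
  simp [slyTrace]

omit [DecidableEq SL] in
/-- The part of `S` on the slots is the image of the trace. [folklore] -/
theorem inter_map_eq_map_slyTrace (V : SL ↪ Fin n) (S : Finset (Fin n)) : S ∩ univ.map V = (slyTrace V S).map V := by
  ext v
  simp only [Finset.mem_inter, Finset.mem_map, Finset.mem_univ, true_and, mem_slyTrace]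
  constructor
  · rintro ⟨hv, s, rfl⟩; exact ⟨s, hv, rfl⟩
  · rintro ⟨s, hs, rfl⟩; exact ⟨hs, s, rfl⟩

/-- **Counting vertex sets with a prescribed trace**: the `a`-subsets of `Fin n` whose trace on the
`J` slots is `χ` number `C(n - J, a - |χ|)` (for `|χ| ≤ a`). [cite: Sly2010, Lemma 3.8 (proof: the configurations `Υ` compatible with `ξ`)] -/
theorem card_powersetCard_filter_slyTrace (V : SL ↪ Fin n) (χ : Finset SL) {a : ℕ} (hχ : χ.card ≤ a) :
    ((univ.powersetCard a).filter fun S : Finset (Fin n) => slyTrace V S = χ).card =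
      (n - Fintype.card SL).choose (a - χ.card) := by
  have hJ : (univ.map V).card = Fintype.card SL := by rw [Finset.card_map, Finset.card_univ]
  have hcompl : ((univ : Finset (Fin n)) \ univ.map V).card = n - Fintype.card SL := by
    rw [Finset.card_univ_sdiff, Fintype.card_fin, hJ]
  rw [← hcompl, ← Finset.card_powersetCard (a - χ.card) ((univ : Finset (Fin n)) \ univ.map V)]
  refine Finset.card_bij' (fun S _ => S \ univ.map V) (fun S₀ _ => S₀ ∪ χ.map V) ?_ ?_ ?_ ?_
  · intro S hS
    rw [Finset.mem_filter, Finset.mem_powersetCard] at hS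
    obtain ⟨⟨-, hSa⟩, hSt⟩ := hS
    rw [Finset.mem_powersetCard]
    refine ⟨Finset.sdiff_subset_sdiff (Finset.subset_univ _) le_rfl, ?_⟩
    have h := Finset.card_sdiff_add_card_inter S (univ.map V)
    rw [inter_map_eq_map_slyTrace, hSt, Finset.card_map, hSa] at h
    omega
  · intro S₀ hS₀
    rw [Finset.mem_powersetCard] at hS₀
    obtain ⟨hsub, hcard⟩ := hS₀
    have hdisj : Disjoint S₀ (χ.map V) := by
      rw [Finset.disjoint_left]
      intro v hv hv'
      have := hsub hv
      rw [Finset.mem_sdiff] at this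
      obtain ⟨s, -, rfl⟩ := Finset.mem_map.1 hv'
      exact this.2 (Finset.mem_map_of_mem _ (Finset.mem_univ s))
    rw [Finset.mem_filter, Finset.mem_powersetCard]
    refine ⟨⟨Finset.subset_univ _, ?_⟩, ?_⟩
    · rw [Finset.card_union_of_disjoint hdisj, Finset.card_map, hcard]; omega
    · ext s
      rw [mem_slyTrace, Finset.mem_union]
      constructor
      · rintro (h | h)
        · exfalso
          have := hsub h
          rw [Finset.mem_sdiff] at this
          exact this.2 (Finset.mem_map_of_mem _ (Finset.mem_univ s))
        · rw [Finset.mem_map' V] at h; exact h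
      · intro h; exact Or.inr ((Finset.mem_map' V).2 h)
  · intro S hS
    rw [Finset.mem_filter] at hS
    rw [← hS.2, ← inter_map_eq_map_slyTrace, Finset.sdiff_union_inter]
  · intro S₀ hS₀
    rw [Finset.mem_powersetCard] at hS₀
    rw [Finset.union_sdiff_distrib, Finset.sdiff_eq_self_of_disjoint, Finset.sdiff_eq_empty_iff_subset.2, Finset.union_empty]
    · exact Finset.map_subset_map.2 (Finset.subset_univ _)
    · rw [Finset.disjoint_left]
      intro v hv hv'
      have := hS₀.1 hv
      rw [Finset.mem_sdiff] at this
      exact this.2 hv'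

/-- Fibrewise summation over the traces, for a summand depending only on the trace. [folklore] -/
theorem sum_powersetCard_eq_sum_slyTrace {M : Type*} [AddCommMonoid M] (V : SL ↪ Fin n) (a : ℕ) (g : Finset SL → M) :
    ∑ S ∈ (univ : Finset (Fin n)).powersetCard a, g (slyTrace V S) =
      ∑ χ : Finset SL, (if χ.card ≤ a then (n - Fintype.card SL).choose (a - χ.card) else 0) • g χ := by
  rw [← Finset.sum_fiberwise_of_maps_to (s := (univ : Finset (Fin n)).powersetCard a) (t := (univ : Finset (Finset SL)))
    (g := slyTrace V) (fun _ _ => Finset.mem_univ _)]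
  refine Finset.sum_congr rfl fun χ _ => ?_
  rw [Finset.sum_congr rfl (fun S hS => by rw [(Finset.mem_filter.1 hS).2] : ∀ S ∈ (univ.powersetCard a).filter (fun S => slyTrace V S = χ),
    g (slyTrace V S) = g χ), Finset.sum_const]
  congr 1
  split_ifs with h
  · exact card_powersetCard_filter_slyTrace V χ h
  · rw [Finset.card_eq_zero, Finset.filter_eq_empty_iff]
    intro S hS hSt
    apply h
    rw [← hSt]
    have hle : (slyTrace V S).card ≤ (S ∩ univ.map V).card := by rw [inter_map_eq_map_slyTrace, Finset.card_map]
    exact hle.trans ((Finset.card_le_card Finset.inter_subset_left).trans (Finset.mem_powersetCard.1 hS).2.le)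

end Traces

section PlantedTraceForm

variable {n m' q k : ℕ} {mv : Fin k → ℕ}

/-- The plus slot map of a vertex-disjoint family, as an embedding. [folklore] -/
def slyFamV {F : (i : Fin k) → Fin (mv i) → SlyWCycle n q ((i : ℕ) + 1)} (hF : SlyFamDisjoint F) :
    (Σ i : Fin k, Fin (mv i) × Fin ((i : ℕ) + 1)) ↪ Fin n :=
  ⟨fun s => (F s.1 s.2.1).v s.2.2, hF.1⟩

/-- The minus slot map of a vertex-disjoint family, as an embedding. [folklore] -/
def slyFamW {F : (i : Fin k) → Fin (mv i) → SlyWCycle n q ((i : ℕ) + 1)} (hF : SlyFamDisjoint F) :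
    (Σ i : Fin k, Fin (mv i) × Fin ((i : ℕ) + 1)) ↪ Fin n :=
  ⟨fun s => (F s.1 s.2.1).w s.2.2, hF.2⟩

/-- The plus slot of a planted edge. [folklore] -/
def slyPlusSlot {F : (i : Fin k) → Fin (mv i) → SlyWCycle n q ((i : ℕ) + 1)} {c : Option (Fin q)} (p : SlyFamEdgesOf F c) :
    Σ i : Fin k, Fin (mv i) × Fin ((i : ℕ) + 1) :=
  ⟨p.1.1, p.1.2.1, slyPlusIdx _ p.1.2.2⟩

/-- The minus slot of a planted edge. [folklore] -/
def slyMinusSlot {F : (i : Fin k) → Fin (mv i) → SlyWCycle n q ((i : ℕ) + 1)} {c : Option (Fin q)} (p : SlyFamEdgesOf F c) :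
    Σ i : Fin k, Fin (mv i) × Fin ((i : ℕ) + 1) :=
  ⟨p.1.1, p.1.2.1, slyMinusIdx _ p.1.2.2⟩

/-- Plus endpoints are the slot images. [folklore] -/
theorem slyFamPE_eq_V {F : (i : Fin k) → Fin (mv i) → SlyWCycle n q ((i : ℕ) + 1)} (hF : SlyFamDisjoint F) {c : Option (Fin q)}
    (p : SlyFamEdgesOf F c) : slyFamPE F c p = slyFamV hF (slyPlusSlot p) := by
  simp [slyFamPE, slyFamV, slyPlusSlot, SlyWCycle.plusEnd_eq]

/-- Minus endpoints are the slot images. [folklore] -/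
theorem slyFamME_eq_W {F : (i : Fin k) → Fin (mv i) → SlyWCycle n q ((i : ℕ) + 1)} (hF : SlyFamDisjoint F) {c : Option (Fin q)}
    (p : SlyFamEdgesOf F c) : slyFamME F c p = slyFamW hF (slyMinusSlot p) := by
  simp [slyFamME, slyFamW, slyMinusSlot, SlyWCycle.minusEnd_eq]

/-- `f⁺_c(χ)`: planted colour-`c` edges whose plus slot is occupied. [cite: Sly2010, Lemma 3.8 (proof: `f₊(k)`)] -/
noncomputable def slyFplus (F : (i : Fin k) → Fin (mv i) → SlyWCycle n q ((i : ℕ) + 1)) (c : Option (Fin q))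
    (χ : Finset (Σ i : Fin k, Fin (mv i) × Fin ((i : ℕ) + 1))) : ℕ :=
  (univ.filter fun p : SlyFamEdgesOf F c => slyPlusSlot p ∈ χ).card

/-- `f⁻_c(χ)`: planted colour-`c` edges whose minus slot is occupied. [cite: Sly2010, Lemma 3.8 (proof: `f₋(k)`)] -/
noncomputable def slyFminus (F : (i : Fin k) → Fin (mv i) → SlyWCycle n q ((i : ℕ) + 1)) (c : Option (Fin q))
    (χ : Finset (Σ i : Fin k, Fin (mv i) × Fin ((i : ℕ) + 1))) : ℕ :=
  (univ.filter fun p : SlyFamEdgesOf F c => slyMinusSlot p ∈ χ).card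

/-- Feasibility in terms of the traces. [folklore] -/
def SlyFamFeasTr (χp χm : Finset (Σ i : Fin k, Fin (mv i) × Fin ((i : ℕ) + 1))) : Prop :=
  ∀ (i : Fin k) (a : Fin (mv i)) (e : Fin ((i : ℕ) + 1) ⊕ Fin ((i : ℕ) + 1)),
    ¬((⟨i, a, slyPlusIdx _ e⟩ : Σ i : Fin k, Fin (mv i) × Fin ((i : ℕ) + 1)) ∈ χp ∧
      (⟨i, a, slyMinusIdx _ e⟩ : Σ i : Fin k, Fin (mv i) × Fin ((i : ℕ) + 1)) ∈ χm)

/-- Feasibility is a property of the traces. [folklore] -/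
theorem slyFamFeasible_iff_tr {F : (i : Fin k) → Fin (mv i) → SlyWCycle n q ((i : ℕ) + 1)} (hF : SlyFamDisjoint F) (S T : Finset (Fin n)) :
    SlyFamFeasible F S T ↔ SlyFamFeasTr (slyTrace (slyFamV hF) S) (slyTrace (slyFamW hF) T) := by
  unfold SlyFamFeasible SlyFamFeasTr
  simp only [mem_slyTrace, slyFamV, slyFamW, Function.Embedding.coeFn_mk, SlyWCycle.plusEnd_eq, SlyWCycle.minusEnd_eq]

/-- **The planted count in trace form**: `N_{a,b}(χ⁺, χ⁻)` — the count of `card_planted_indep` as a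
function of the slice sizes and the traces of `(S, T)` on the cycle slots. [cite: Sly2010, Lemma 3.8 (proof: `P2`)] -/
noncomputable def slyPlantedN (F : (i : Fin k) → Fin (mv i) → SlyWCycle n q ((i : ℕ) + 1)) (m' a b ep em : ℕ)
    (χp χm : Finset (Σ i : Fin k, Fin (mv i) × Fin ((i : ℕ) + 1))) : ℕ :=
  (∏ c : Fin q,
    ((n + m' - Fintype.card (SlyFamEdgesOf F (some c)) - (b + em - slyFminus F (some c) χm)).descFactorial
        (a + ep - slyFplus F (some c) χp) *
      (n + m' - Fintype.card (SlyFamEdgesOf F (some c)) - (a + ep - slyFplus F (some c) χp)).factorial)) *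
  ((n - Fintype.card (SlyFamEdgesOf F none) - (b - slyFminus F none χm)).descFactorial (a - slyFplus F none χp) *
    (n - Fintype.card (SlyFamEdgesOf F none) - (a - slyFplus F none χp)).factorial)

open scoped Classical in
/-- The planted count depends on `(S, T)` only through the slice sizes and the traces. [cite: Sly2010, Lemma 3.8 (proof)] -/
theorem card_planted_indep_eq_slyPlantedN {F : (i : Fin k) → Fin (mv i) → SlyWCycle n q ((i : ℕ) + 1)} (hF : SlyFamDisjoint F)
    (S T : Finset (Fin n)) (Ep Em : Finset (Fin m')) (hfeas : SlyFamFeasible F S T) :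
    Fintype.card {ω : (Fin q → Equiv.Perm (Fin (n + m'))) × Equiv.Perm (Fin n) //
        (∀ i a, (F i a).Present ω.1 ω.2) ∧ SlyCoreIndep ω.1 ω.2 S T Ep Em} =
      slyPlantedN F m' S.card T.card Ep.card Em.card (slyTrace (slyFamV hF) S) (slyTrace (slyFamW hF) T) := by
  rw [card_planted_indep hF S T Ep Em hfeas]
  unfold slyPlantedN
  -- identify the four cardinalities
  have hfp : ∀ c : Option (Fin q), (univ.filter fun p : SlyFamEdgesOf F c => slyFamPE F c p ∈ S).card = slyFplus F c (slyTrace (slyFamV hF) S) := by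
    intro c; unfold slyFplus; congr 1; ext p; simp [mem_slyTrace, slyFamPE_eq_V hF]
  have hfm : ∀ c : Option (Fin q), (univ.filter fun p : SlyFamEdgesOf F c => slyFamME F c p ∈ T).card = slyFminus F c (slyTrace (slyFamW hF) T) := by
    intro c; unfold slyFminus; congr 1; ext p; simp [mem_slyTrace, slyFamME_eq_W hF]
  have hA : ∀ c : Fin q, (slyFamAσ F S Ep c).card = S.card + Ep.card - slyFplus F (some c) (slyTrace (slyFamV hF) S) := by
    intro c; have := card_slyFamAσ hF S Ep c; rw [hfp] at this; omega
  have hB : ∀ c : Fin q, ((T.map (Fin.castAddEmb m') ∪ Em.map (Fin.natAddEmb n)) \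
      univ.image (fun p : SlyFamEdgesOf F (some c) => Fin.castAdd m' (slyFamME F (some c) p))).card =
      T.card + Em.card - slyFminus F (some c) (slyTrace (slyFamW hF) T) := by
    intro c; have := card_Bσ_sdiff hF T Em c; rw [hfm] at this; omega
  have hAτ : (slyFamAτ F S).card = S.card - slyFplus F none (slyTrace (slyFamV hF) S) := by
    have := card_slyFamAτ hF S; rw [hfp] at this; omega
  have hTτ : (T \ univ.image (slyFamME F none)).card = T.card - slyFminus F none (slyTrace (slyFamW hF) T) := by
    have := card_T_sdiff hF T; rw [hfm] at this; omega
  simp only [hA, hB, hAτ, hTτ]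

open scoped Classical in
/-- **The planted slice sum in trace form** (Sly's `Σ_Υ P1·P2` for a fixed family): summing the
planted counts over the slice configurations `|S| = a`, `|T| = b` groups them by their traces on the
cycle slots, with `C(n-J, a-|χ⁺|) C(n-J, b-|χ⁻|)` configurations per trace pair.
[cite: Sly2010, Lemma 3.8 (proof: eq. (e:cycleRatio) with the configurations `Υ` compatible with `ξ`)] -/
theorem sum_planted_slice {F : (i : Fin k) → Fin (mv i) → SlyWCycle n q ((i : ℕ) + 1)} (hF : SlyFamDisjoint F)
    (a b : ℕ) (Ep Em : Finset (Fin m')) :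
    ∑ S ∈ (univ : Finset (Fin n)).powersetCard a, ∑ T ∈ (univ : Finset (Fin n)).powersetCard b,
        Fintype.card {ω : (Fin q → Equiv.Perm (Fin (n + m'))) × Equiv.Perm (Fin n) //
          (∀ i a, (F i a).Present ω.1 ω.2) ∧ SlyCoreIndep ω.1 ω.2 S T Ep Em} =
      ∑ χp : Finset (Σ i : Fin k, Fin (mv i) × Fin ((i : ℕ) + 1)), ∑ χm : Finset (Σ i : Fin k, Fin (mv i) × Fin ((i : ℕ) + 1)),
        (if χp.card ≤ a then (n - slyFamJ mv).choose (a - χp.card) else 0) *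
          ((if χm.card ≤ b then (n - slyFamJ mv).choose (b - χm.card) else 0) *
            (if SlyFamFeasTr χp χm then slyPlantedN F m' a b Ep.card Em.card χp χm else 0)) := by
  -- the summand as a function of the two traces
  have hsummand : ∀ S ∈ (univ : Finset (Fin n)).powersetCard a, ∀ T ∈ (univ : Finset (Fin n)).powersetCard b,
      Fintype.card {ω : (Fin q → Equiv.Perm (Fin (n + m'))) × Equiv.Perm (Fin n) //
          (∀ i a, (F i a).Present ω.1 ω.2) ∧ SlyCoreIndep ω.1 ω.2 S T Ep Em} =
        (if SlyFamFeasTr (slyTrace (slyFamV hF) S) (slyTrace (slyFamW hF) T) then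
          slyPlantedN F m' a b Ep.card Em.card (slyTrace (slyFamV hF) S) (slyTrace (slyFamW hF) T) else 0) := by
    intro S hS T hT
    have hSa : S.card = a := (Finset.mem_powersetCard.1 hS).2
    have hTb : T.card = b := (Finset.mem_powersetCard.1 hT).2
    split_ifs with h
    · rw [card_planted_indep_eq_slyPlantedN hF S T Ep Em ((slyFamFeasible_iff_tr hF S T).2 h), hSa, hTb]
    · exact card_planted_indep_eq_zero S T Ep Em (fun h' => h ((slyFamFeasible_iff_tr hF S T).1 h'))
  rw [Finset.sum_congr rfl fun S hS => Finset.sum_congr rfl fun T hT => hsummand S hS T hT]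
  -- fibre over the traces, first `T`, then `S`
  have hJ : Fintype.card (Σ i : Fin k, Fin (mv i) × Fin ((i : ℕ) + 1)) = slyFamJ mv := card_slyFamSlots mv
  rw [Finset.sum_congr rfl fun S _ => sum_powersetCard_eq_sum_slyTrace (slyFamW hF) b
    (fun χm => if SlyFamFeasTr (slyTrace (slyFamV hF) S) χm then slyPlantedN F m' a b Ep.card Em.card (slyTrace (slyFamV hF) S) χm else 0)]
  rw [sum_powersetCard_eq_sum_slyTrace (slyFamV hF) a
    (fun χp => ∑ χm : Finset (Σ i : Fin k, Fin (mv i) × Fin ((i : ℕ) + 1)),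
      (if χm.card ≤ b then (n - Fintype.card (Σ i : Fin k, Fin (mv i) × Fin ((i : ℕ) + 1))).choose (b - χm.card) else 0) •
        (if SlyFamFeasTr χp χm then slyPlantedN F m' a b Ep.card Em.card χp χm else 0))]
  simp only [hJ, smul_eq_mul, Finset.mul_sum]

end PlantedTraceForm

section PlantedRatio

variable {n m' q k : ℕ} {mv : Fin k → ℕ}

/-- The per-colour normalisation: `X^{(A)} (N-e-A)! / N! = [C(X, A)/C(N-e, A)] / N^{(e)}` with
`X = N - e - B` (prescribing `e` edges costs `1/N^{(e)}` = Sly's `P1`; the avoidance is the binomial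
ratio of `P2`). [cite: Sly2010, Lemma 3.8 (proof: `P1`, `P2`)] -/
theorem planted_factor_div (N e A B : ℕ) (hA : A + e ≤ N) :
    (((N - e - B).descFactorial A * (N - e - A).factorial : ℕ) : ℝ) / (N.factorial : ℝ) =
      (((N - e - B).choose A : ℝ) / ((N - e).choose A)) / (N.descFactorial e : ℝ) := by
  have he : e ≤ N := by omega
  have hAe : A ≤ N - e := by omega
  have hsplit : (N.factorial : ℝ) = ((N - e).factorial : ℝ) * (N.descFactorial e : ℝ) := by
    exact_mod_cast (Nat.factorial_mul_descFactorial he).symm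
  have hdesc : (0 : ℝ) < N.descFactorial e := by exact_mod_cast Nat.descFactorial_pos.2 he
  have hfac : (0 : ℝ) < (N - e).factorial := by exact_mod_cast Nat.factorial_pos _
  rw [hsplit, ← descFactorial_mul_factorial_div_factorial (N - e) A (N - e - B) hAe]
  rw [show N - e - A = (N - e) - A from rfl]
  field_simp

/-- `f⁺_c(χ) ≤ |χ|`: distinct planted edges of one colour have distinct plus slots. [folklore] -/
theorem slyFplus_le_card {F : (i : Fin k) → Fin (mv i) → SlyWCycle n q ((i : ℕ) + 1)} (hF : SlyFamDisjoint F) (c : Option (Fin q))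
    (χ : Finset (Σ i : Fin k, Fin (mv i) × Fin ((i : ℕ) + 1))) : slyFplus F c χ ≤ χ.card := by
  classical
  unfold slyFplus
  have hinj : Function.Injective (fun p : SlyFamEdgesOf F c => slyPlusSlot p) := by
    intro p p' h
    apply slyFamPE_injective hF c
    rw [slyFamPE_eq_V hF, slyFamPE_eq_V hF]
    exact congrArg (slyFamV hF) h
  calc (univ.filter fun p : SlyFamEdgesOf F c => slyPlusSlot p ∈ χ).card
      = ((univ.filter fun p : SlyFamEdgesOf F c => slyPlusSlot p ∈ χ).image fun p => slyPlusSlot p).card :=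
        (Finset.card_image_of_injective _ hinj).symm
    _ ≤ χ.card := Finset.card_le_card (by intro s hs; obtain ⟨p, hp, rfl⟩ := Finset.mem_image.1 hs; exact (Finset.mem_filter.1 hp).2)

/-- `f⁻_c(χ) ≤ |χ|`. [folklore] -/
theorem slyFminus_le_card {F : (i : Fin k) → Fin (mv i) → SlyWCycle n q ((i : ℕ) + 1)} (hF : SlyFamDisjoint F) (c : Option (Fin q))
    (χ : Finset (Σ i : Fin k, Fin (mv i) × Fin ((i : ℕ) + 1))) : slyFminus F c χ ≤ χ.card := by
  classical
  unfold slyFminus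
  have hinj : Function.Injective (fun p : SlyFamEdgesOf F c => slyMinusSlot p) := by
    intro p p' h
    apply slyFamME_injective hF c
    rw [slyFamME_eq_W hF, slyFamME_eq_W hF]
    exact congrArg (slyFamW hF) h
  calc (univ.filter fun p : SlyFamEdgesOf F c => slyMinusSlot p ∈ χ).card
      = ((univ.filter fun p : SlyFamEdgesOf F c => slyMinusSlot p ∈ χ).image fun p => slyMinusSlot p).card :=
        (Finset.card_image_of_injective _ hinj).symm
    _ ≤ χ.card := Finset.card_le_card (by intro s hs; obtain ⟨p, hp, rfl⟩ := Finset.mem_image.1 hs; exact (Finset.mem_filter.1 hp).2)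

/-- The number of planted edges of a colour is at most `2J`. [folklore] -/
theorem card_slyFamEdgesOf_le (F : (i : Fin k) → Fin (mv i) → SlyWCycle n q ((i : ℕ) + 1)) (c : Option (Fin q)) :
    Fintype.card (SlyFamEdgesOf F c) ≤ 2 * slyFamJ mv := by
  classical
  calc Fintype.card (SlyFamEdgesOf F c) ≤ Fintype.card (Σ i : Fin k, Fin (mv i) × (Fin ((i : ℕ) + 1) ⊕ Fin ((i : ℕ) + 1))) :=
        Fintype.card_subtype_le _
    _ = 2 * slyFamJ mv := by
        rw [Fintype.card_sigma]
        unfold slyFamJ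
        rw [Finset.mul_sum]
        refine Finset.sum_congr rfl fun i _ => ?_
        simp only [Fintype.card_prod, Fintype.card_sum, Fintype.card_fin]; ring

open scoped Classical in
/-- **The planted count, normalised** (`P1 · P2` of Sly's Lemma 3.8 for a family and a trace pair):
`N_{a,b}(χ⁺,χ⁻)/N_tot = Π_c [C(N-e_c-b'+f⁻_c, a'-f⁺_c)/C(N-e_c, a'-f⁺_c)]/N^{(e_c)} ·
[C(n-e_τ-b+f⁻_τ, a-f⁺_τ)/C(n-e_τ, a-f⁺_τ)]/n^{(e_τ)}` (`a' = a+|E⁺|`, `b' = b+|E⁻|`, `N = n+m'`),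
for `a + 2J ≤ n`. [cite: Sly2010, Lemma 3.8 (proof: eqs. (e:cycleRatio), (e:P2expression))] -/
theorem slyPlantedN_div (F : (i : Fin k) → Fin (mv i) → SlyWCycle n q ((i : ℕ) + 1))
    {a b ep em : ℕ} (hep : ep ≤ m') (ha : a + 2 * slyFamJ mv ≤ n)
    (χp χm : Finset (Σ i : Fin k, Fin (mv i) × Fin ((i : ℕ) + 1))) :
    (slyPlantedN F m' a b ep em χp χm : ℝ) / ((((n + m').factorial : ℝ) ^ q) * (n.factorial : ℝ)) =
      (∏ c : Fin q,
        (((n + m' - Fintype.card (SlyFamEdgesOf F (some c)) - (b + em - slyFminus F (some c) χm)).choose (a + ep - slyFplus F (some c) χp) : ℝ) /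
            ((n + m' - Fintype.card (SlyFamEdgesOf F (some c))).choose (a + ep - slyFplus F (some c) χp))) /
          ((n + m').descFactorial (Fintype.card (SlyFamEdgesOf F (some c))) : ℝ)) *
      ((((n - Fintype.card (SlyFamEdgesOf F none) - (b - slyFminus F none χm)).choose (a - slyFplus F none χp) : ℝ) /
          ((n - Fintype.card (SlyFamEdgesOf F none)).choose (a - slyFplus F none χp))) /
        (n.descFactorial (Fintype.card (SlyFamEdgesOf F none)) : ℝ)) := by
  unfold slyPlantedN
  push_cast
  rw [show (((n + m').factorial : ℝ) ^ q) = ∏ _c : Fin q, ((n + m').factorial : ℝ) by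
    rw [Finset.prod_const, Finset.card_univ, Fintype.card_fin], mul_div_mul_comm, ← Finset.prod_div_distrib]
  congr 1
  · refine Finset.prod_congr rfl fun c _ => ?_
    have h := planted_factor_div (n + m') (Fintype.card (SlyFamEdgesOf F (some c))) (a + ep - slyFplus F (some c) χp)
      (b + em - slyFminus F (some c) χm) (by have := card_slyFamEdgesOf_le F (some c); omega)
    push_cast at h
    exact h
  · have h := planted_factor_div n (Fintype.card (SlyFamEdgesOf F none)) (a - slyFplus F none χp) (b - slyFminus F none χm)
      (by have := card_slyFamEdgesOf_le F none; omega)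
    push_cast at h
    exact h

end PlantedRatio

section TraceFactorisation

variable {n q k : ℕ} {mv : Fin k → ℕ}

/-- Sums over pairs of finsets are sums over pairs of indicator functions. [folklore] -/
theorem sum_finset_eq_sum_indicator {SL : Type*} [Fintype SL] [DecidableEq SL] {M : Type*} [AddCommMonoid M]
    (G : Finset SL → M) : ∑ χ : Finset SL, G χ = ∑ g : SL → Bool, G (univ.filter fun s => g s = true) := by
  refine (Fintype.sum_equiv (Equiv.mk (fun g : SL → Bool => univ.filter fun s => g s = true)
    (fun χ : Finset SL => fun s => decide (s ∈ χ)) (fun g => by ext s; simp) (fun χ => by ext s; simp)) _ _ (fun g => rfl)).symm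

/-- `slyOk b₁ b₂ = 1` unless both are occupied. [folklore] -/
theorem slyOk_eq_one_iff (b₁ b₂ : Bool) : slyOk b₁ b₂ = 1 ↔ (b₁ && b₂) = false := by
  cases b₁ <;> cases b₂ <;> simp [slyOk]

/-- `slyOk b₁ b₂ = 0` iff both are occupied. [folklore] -/
theorem slyOk_eq_zero_iff (b₁ b₂ : Bool) : slyOk b₁ b₂ = 0 ↔ (b₁ && b₂) = true := by
  cases b₁ <;> cases b₂ <;> simp [slyOk]

/-- Powers of the occupied count are products of weights. [folklore] -/
theorem pow_card_filter_eq_prod_slyWt {SL : Type*} [Fintype SL] (w : ℝ) (g : SL → Bool) :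
    w ^ (univ.filter fun s => g s = true).card = ∏ s : SL, slyWt w (g s) := by
  unfold slyWt
  rw [Finset.prod_ite, Finset.prod_const, Finset.prod_const_one, mul_one]

/-- Feasibility of a trace pair given by indicator functions, slot by slot. [folklore] -/
theorem slyFamFeasTr_indicator_iff (gp gm : (Σ i : Fin k, Fin (mv i) × Fin ((i : ℕ) + 1)) → Bool) :
    SlyFamFeasTr (univ.filter fun s => gp s = true) (univ.filter fun s => gm s = true) ↔
      ∀ s : (Σ i : Fin k, Fin (mv i) × Fin ((i : ℕ) + 1)),
        (gp s && gm s) = false ∧ (gm s && gp ⟨s.1, s.2.1, finRotate _ s.2.2⟩) = false := by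
  unfold SlyFamFeasTr
  simp only [Finset.mem_filter, Finset.mem_univ, true_and]
  constructor
  · intro h s
    obtain ⟨i, a, t⟩ := s
    have h1 := h i a (Sum.inl t)
    have h2 := h i a (Sum.inr t)
    simp only [slyPlusIdx, slyMinusIdx] at h1 h2
    constructor
    · cases hp : gp ⟨i, a, t⟩ <;> cases hm : gm ⟨i, a, t⟩ <;> simp_all
    · cases hp : gp ⟨i, a, finRotate _ t⟩ <;> cases hm : gm ⟨i, a, t⟩ <;> simp_all
  · intro h i a e
    cases e with
    | inl t =>
      have h1 := (h ⟨i, a, t⟩).1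
      simp only [slyPlusIdx, slyMinusIdx]
      cases hp : gp ⟨i, a, t⟩ <;> cases hm : gm ⟨i, a, t⟩ <;> simp_all
    | inr t =>
      have h2 := (h ⟨i, a, t⟩).2
      simp only [slyPlusIdx, slyMinusIdx]
      cases hp : gp ⟨i, a, finRotate _ t⟩ <;> cases hm : gm ⟨i, a, t⟩ <;> simp_all

open scoped Classical in
/-- **The limit trace weight** of an occupancy pair `(gp, gm)` of the slots of a family: feasibility
indicator times `u^{#occupied plus} v^{#occupied minus}`, in product form, cycle by cycle.
[cite: Sly2010, Lemma 3.8 (proof: the weight of a 2-colouring `ξ`)] -/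
theorem traceWeight_eq_prod (u v : ℝ) (gp gm : (Σ i : Fin k, Fin (mv i) × Fin ((i : ℕ) + 1)) → Bool) :
    ((if SlyFamFeasTr (univ.filter fun s => gp s = true) (univ.filter fun s => gm s = true) then (1 : ℝ) else 0) *
        (u ^ (univ.filter fun s => gp s = true).card * v ^ (univ.filter fun s => gm s = true).card)) =
      ∏ i : Fin k, ∏ a : Fin (mv i), ∏ t : Fin ((i : ℕ) + 1),
        slyOk (gp ⟨i, a, t⟩) (gm ⟨i, a, t⟩) * slyOk (gm ⟨i, a, t⟩) (gp ⟨i, a, finRotate _ t⟩) *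
          slyWt u (gp ⟨i, a, t⟩) * slyWt v (gm ⟨i, a, t⟩) := by
  classical
  -- the right-hand side as a product over all slots
  have hR : (∏ i : Fin k, ∏ a : Fin (mv i), ∏ t : Fin ((i : ℕ) + 1),
        slyOk (gp ⟨i, a, t⟩) (gm ⟨i, a, t⟩) * slyOk (gm ⟨i, a, t⟩) (gp ⟨i, a, finRotate _ t⟩) *
          slyWt u (gp ⟨i, a, t⟩) * slyWt v (gm ⟨i, a, t⟩)) =
      ∏ s : (Σ i : Fin k, Fin (mv i) × Fin ((i : ℕ) + 1)),
        (slyOk (gp s) (gm s) * slyOk (gm s) (gp ⟨s.1, s.2.1, finRotate _ s.2.2⟩)) * (slyWt u (gp s) * slyWt v (gm s)) := by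
    rw [Fintype.prod_sigma]
    refine Finset.prod_congr rfl fun i _ => ?_
    rw [Fintype.prod_prod_type]
    refine Finset.prod_congr rfl fun a _ => Finset.prod_congr rfl fun t _ => ?_
    ring
  rw [hR, Finset.prod_mul_distrib, Finset.prod_mul_distrib (f := fun s => slyWt u (gp s)) (g := fun s => slyWt v (gm s)),
    ← pow_card_filter_eq_prod_slyWt, ← pow_card_filter_eq_prod_slyWt]
  congr 1
  -- the constraint product is the feasibility indicator
  split_ifs with hfeas
  · rw [slyFamFeasTr_indicator_iff] at hfeas
    symm
    refine Finset.prod_eq_one fun s _ => ?_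
    rw [(slyOk_eq_one_iff _ _).2 (hfeas s).1, (slyOk_eq_one_iff _ _).2 (hfeas s).2, mul_one]
  · rw [slyFamFeasTr_indicator_iff] at hfeas
    obtain ⟨s, hs⟩ := not_forall.1 hfeas
    symm
    refine Finset.prod_eq_zero (Finset.mem_univ s) ?_
    rcases not_and_or.1 hs with h1 | h2
    · rw [(slyOk_eq_zero_iff _ _).2 (by simpa using h1), zero_mul]
    · rw [(slyOk_eq_zero_iff (gm s) (gp ⟨s.1, s.2.1, finRotate _ s.2.2⟩)).2 (by simpa using h2), mul_zero]

/-- Regrouping functions on the slot type cycle by cycle. [folklore] -/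
def slySlotCurry (k : ℕ) (mv : Fin k → ℕ) :
    (((Σ i : Fin k, Fin (mv i) × Fin ((i : ℕ) + 1)) → Bool) × ((Σ i : Fin k, Fin (mv i) × Fin ((i : ℕ) + 1)) → Bool)) ≃
      ((p : Σ i : Fin k, Fin (mv i)) → (Fin ((p.1 : ℕ) + 1) → Bool) × (Fin ((p.1 : ℕ) + 1) → Bool)) where
  toFun g := fun p => (fun t => g.1 ⟨p.1, p.2, t⟩, fun t => g.2 ⟨p.1, p.2, t⟩)
  invFun G := (fun s => (G ⟨s.1, s.2.1⟩).1 s.2.2, fun s => (G ⟨s.1, s.2.1⟩).2 s.2.2)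
  left_inv _ := rfl
  right_inv _ := rfl

open scoped Classical in
/-- **Factorisation of the limit trace sum over the cycles of the family**:
`Σ_{(χ⁺,χ⁻) feasible} c^J u^{|χ⁺|} v^{|χ⁻|} = Π_i (c^{i+1} CycleSum_{i+1}(u,v))^{m_i}`.
[cite: Sly2010, Lemma 3.8 (proof: independence of the cycles' 2-colourings, giving `Π (1+δ_i)^{m_i}`)] -/
theorem sum_traceWeight_eq_prod_cycleSum (u v c : ℝ) (mv : Fin k → ℕ) :
    ∑ χp : Finset (Σ i : Fin k, Fin (mv i) × Fin ((i : ℕ) + 1)), ∑ χm : Finset (Σ i : Fin k, Fin (mv i) × Fin ((i : ℕ) + 1)),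
        (if SlyFamFeasTr χp χm then (1 : ℝ) else 0) * (c ^ slyFamJ mv * (u ^ χp.card * v ^ χm.card)) =
      ∏ i : Fin k, (c ^ ((i : ℕ) + 1) * slyCycleSum u v ((i : ℕ) + 1)) ^ mv i := by
  classical
  -- pass to indicator functions and to the product form
  rw [sum_finset_eq_sum_indicator]
  simp_rw [sum_finset_eq_sum_indicator (SL := (Σ i : Fin k, Fin (mv i) × Fin ((i : ℕ) + 1)))
    (G := fun χm => (if SlyFamFeasTr _ χm then (1 : ℝ) else 0) * (c ^ slyFamJ mv * (u ^ _ * v ^ χm.card)))]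
  have hterm : ∀ gp gm : (Σ i : Fin k, Fin (mv i) × Fin ((i : ℕ) + 1)) → Bool,
      (if SlyFamFeasTr (univ.filter fun s => gp s = true) (univ.filter fun s => gm s = true) then (1 : ℝ) else 0) *
          (c ^ slyFamJ mv * (u ^ (univ.filter fun s => gp s = true).card * v ^ (univ.filter fun s => gm s = true).card)) =
        ∏ p : (Σ i : Fin k, Fin (mv i)),
          (c ^ ((p.1 : ℕ) + 1) * ∏ t : Fin ((p.1 : ℕ) + 1),
            slyOk ((slySlotCurry k mv (gp, gm) p).1 t) ((slySlotCurry k mv (gp, gm) p).2 t) *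
              slyOk ((slySlotCurry k mv (gp, gm) p).2 t) ((slySlotCurry k mv (gp, gm) p).1 (finRotate _ t)) *
              slyWt u ((slySlotCurry k mv (gp, gm) p).1 t) * slyWt v ((slySlotCurry k mv (gp, gm) p).2 t)) := by
    intro gp gm
    rw [mul_left_comm, traceWeight_eq_prod, Finset.prod_mul_distrib]
    congr 1
    · -- `c^J = Π_p c^{i+1}`
      rw [Fintype.prod_sigma]
      unfold slyFamJ
      rw [← Finset.prod_pow_eq_pow_sum]
      refine Finset.prod_congr rfl fun i _ => ?_
      rw [show (∏ y : Fin (mv i), c ^ (((⟨i, y⟩ : Σ i : Fin k, Fin (mv i)).1 : ℕ) + 1)) = ∏ _y : Fin (mv i), c ^ ((i : ℕ) + 1) from rfl,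
        Finset.prod_const, Finset.card_univ, Fintype.card_fin, ← pow_mul, mul_comm]
    · rw [Fintype.prod_sigma]
      rfl
  simp_rw [hterm]
  -- sum over pairs of functions = sum over curried functions; then distribute
  rw [← Fintype.sum_prod_type', ← (slySlotCurry k mv).symm.sum_comp]
  simp only [Prod.mk.eta, Equiv.apply_symm_apply]
  rw [← Fintype.prod_sum (fun (p : Σ i : Fin k, Fin (mv i)) (x : (Fin ((p.1 : ℕ) + 1) → Bool) × (Fin ((p.1 : ℕ) + 1) → Bool)) =>
    c ^ ((p.1 : ℕ) + 1) * ∏ t : Fin ((p.1 : ℕ) + 1),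
      slyOk (x.1 t) (x.2 t) * slyOk (x.2 t) (x.1 (finRotate _ t)) * slyWt u (x.1 t) * slyWt v (x.2 t))]
  -- each factor is `c^{i+1} CycleSum_{i+1}`
  have hfac : ∀ p : (Σ i : Fin k, Fin (mv i)),
      (∑ x : (Fin ((p.1 : ℕ) + 1) → Bool) × (Fin ((p.1 : ℕ) + 1) → Bool), c ^ ((p.1 : ℕ) + 1) * ∏ t : Fin ((p.1 : ℕ) + 1),
        slyOk (x.1 t) (x.2 t) * slyOk (x.2 t) (x.1 (finRotate _ t)) * slyWt u (x.1 t) * slyWt v (x.2 t)) =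
        c ^ ((p.1 : ℕ) + 1) * slyCycleSum u v ((p.1 : ℕ) + 1) := by
    intro p
    unfold slyCycleSum
    rw [← Finset.mul_sum, Fintype.sum_prod_type]
  simp_rw [hfac]
  rw [Fintype.prod_sigma]
  refine Finset.prod_congr rfl fun i _ => ?_
  rw [Finset.prod_eq_pow_card (b := c ^ ((i : ℕ) + 1) * slyCycleSum u v ((i : ℕ) + 1)) (fun y _ => rfl), Finset.card_univ,
    Fintype.card_fin]

end TraceFactorisation

section OverlapPlanted

variable {n m' q : ℕ}

/-- The colour class of a key set. [folklore] -/
noncomputable def slyKeyClass (U : Finset (Option (Fin q) × Fin n × Fin n)) (c : Option (Fin q)) :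
    Finset (Option (Fin q) × Fin n × Fin n) :=
  U.filter fun ε => ε.1 = c

open scoped Classical in
/-- **Planting an arbitrary coloured edge set, upper bound**: the realisations containing every edge
of `U` in which `S ∪ E⁺ ∪ T ∪ E⁻` is independent are at most, colour by colour, the permutations
with the colour class prescribed that map no NON-planted occupied plus vertex to an occupied minus
vertex (the avoidance constraints at planted endpoints are dropped). [cite: Sly2010, Lemma 3.8 (proof: the overlapping configurations)] -/
theorem card_presentU_indep_le (U : Finset (Option (Fin q) × Fin n × Fin n)) (S T : Finset (Fin n)) (Ep Em : Finset (Fin m')) :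
    Fintype.card {ω : (Fin q → Equiv.Perm (Fin (n + m'))) × Equiv.Perm (Fin n) //
        (∀ ε ∈ U, SlyTriplePresent ω.1 ω.2 ε) ∧ SlyCoreIndep ω.1 ω.2 S T Ep Em} ≤
      (∏ c : Fin q, Fintype.card {π : Equiv.Perm (Fin (n + m')) //
          (∀ ε : slyKeyClass U (some c), π (Fin.castAdd m' ε.1.2.1) = Fin.castAdd m' ε.1.2.2) ∧
            ∀ v ∈ (S.map (Fin.castAddEmb m') ∪ Ep.map (Fin.natAddEmb n)) \
                (slyKeyClass U (some c)).image (fun ε => Fin.castAdd m' ε.2.1),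
              π v ∉ T.map (Fin.castAddEmb m') ∪ Em.map (Fin.natAddEmb n)}) *
        Fintype.card {τ : Equiv.Perm (Fin n) //
          (∀ ε : slyKeyClass U none, τ ε.1.2.1 = ε.1.2.2) ∧ ∀ v ∈ S \ (slyKeyClass U none).image (fun ε => ε.2.1), τ v ∉ T} := by
  -- the event implies the product event
  have himp : ∀ ω : (Fin q → Equiv.Perm (Fin (n + m'))) × Equiv.Perm (Fin n),
      ((∀ ε ∈ U, SlyTriplePresent ω.1 ω.2 ε) ∧ SlyCoreIndep ω.1 ω.2 S T Ep Em) →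
        (∀ c : Fin q, (∀ ε : slyKeyClass U (some c), ω.1 c (Fin.castAdd m' ε.1.2.1) = Fin.castAdd m' ε.1.2.2) ∧
            ∀ v ∈ (S.map (Fin.castAddEmb m') ∪ Ep.map (Fin.natAddEmb n)) \
                (slyKeyClass U (some c)).image (fun ε => Fin.castAdd m' ε.2.1),
              ω.1 c v ∉ T.map (Fin.castAddEmb m') ∪ Em.map (Fin.natAddEmb n)) ∧
          ((∀ ε : slyKeyClass U none, ω.2 ε.1.2.1 = ε.1.2.2) ∧ ∀ v ∈ S \ (slyKeyClass U none).image (fun ε => ε.2.1), ω.2 v ∉ T) := by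
    rintro ⟨σ, τ⟩ ⟨hpres, hind1, hind2⟩
    refine ⟨fun c => ⟨fun ε => ?_, fun v hv => hind1 c v (Finset.mem_sdiff.1 hv).1⟩, fun ε => ?_, fun v hv => hind2 v (Finset.mem_sdiff.1 hv).1⟩
    · obtain ⟨⟨c', p, m⟩, hε⟩ := ε
      obtain ⟨hU, hc⟩ := Finset.mem_filter.1 hε
      simp only at hc
      subst hc
      exact hpres _ hU
    · obtain ⟨⟨c', p, m⟩, hε⟩ := ε
      obtain ⟨hU, hc⟩ := Finset.mem_filter.1 hε
      simp only at hc
      subst hc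
      exact hpres _ hU
  calc Fintype.card {ω : (Fin q → Equiv.Perm (Fin (n + m'))) × Equiv.Perm (Fin n) //
          (∀ ε ∈ U, SlyTriplePresent ω.1 ω.2 ε) ∧ SlyCoreIndep ω.1 ω.2 S T Ep Em}
      ≤ Fintype.card {ω : (Fin q → Equiv.Perm (Fin (n + m'))) × Equiv.Perm (Fin n) //
          (∀ c : Fin q, (∀ ε : slyKeyClass U (some c), ω.1 c (Fin.castAdd m' ε.1.2.1) = Fin.castAdd m' ε.1.2.2) ∧
              ∀ v ∈ (S.map (Fin.castAddEmb m') ∪ Ep.map (Fin.natAddEmb n)) \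
                  (slyKeyClass U (some c)).image (fun ε => Fin.castAdd m' ε.2.1),
                ω.1 c v ∉ T.map (Fin.castAddEmb m') ∪ Em.map (Fin.natAddEmb n)) ∧
            ((∀ ε : slyKeyClass U none, ω.2 ε.1.2.1 = ε.1.2.2) ∧ ∀ v ∈ S \ (slyKeyClass U none).image (fun ε => ε.2.1), ω.2 v ∉ T)} :=
        Fintype.card_subtype_mono _ _ himp
    _ = _ := by
        rw [Fintype.card_subtype]
        have hprod : (univ.filter fun ω : (Fin q → Equiv.Perm (Fin (n + m'))) × Equiv.Perm (Fin n) =>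
            (∀ c : Fin q, (∀ ε : slyKeyClass U (some c), ω.1 c (Fin.castAdd m' ε.1.2.1) = Fin.castAdd m' ε.1.2.2) ∧
                ∀ v ∈ (S.map (Fin.castAddEmb m') ∪ Ep.map (Fin.natAddEmb n)) \
                    (slyKeyClass U (some c)).image (fun ε => Fin.castAdd m' ε.2.1),
                  ω.1 c v ∉ T.map (Fin.castAddEmb m') ∪ Em.map (Fin.natAddEmb n)) ∧
              ((∀ ε : slyKeyClass U none, ω.2 ε.1.2.1 = ε.1.2.2) ∧ ∀ v ∈ S \ (slyKeyClass U none).image (fun ε => ε.2.1), ω.2 v ∉ T)) =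
          (univ.filter fun σ : Fin q → Equiv.Perm (Fin (n + m')) => ∀ c : Fin q,
              (∀ ε : slyKeyClass U (some c), σ c (Fin.castAdd m' ε.1.2.1) = Fin.castAdd m' ε.1.2.2) ∧
                ∀ v ∈ (S.map (Fin.castAddEmb m') ∪ Ep.map (Fin.natAddEmb n)) \
                    (slyKeyClass U (some c)).image (fun ε => Fin.castAdd m' ε.2.1),
                  σ c v ∉ T.map (Fin.castAddEmb m') ∪ Em.map (Fin.natAddEmb n)) ×ˢ
          (univ.filter fun τ : Equiv.Perm (Fin n) =>
              (∀ ε : slyKeyClass U none, τ ε.1.2.1 = ε.1.2.2) ∧ ∀ v ∈ S \ (slyKeyClass U none).image (fun ε => ε.2.1), τ v ∉ T) := by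
          ext ω
          simp only [Finset.mem_filter, Finset.mem_product, Finset.mem_univ, true_and]
        rw [hprod, Finset.card_product, Fintype.card_subtype]
        congr 1
        have hpi : (univ.filter fun σ : Fin q → Equiv.Perm (Fin (n + m')) => ∀ c : Fin q,
              (∀ ε : slyKeyClass U (some c), σ c (Fin.castAdd m' ε.1.2.1) = Fin.castAdd m' ε.1.2.2) ∧
                ∀ v ∈ (S.map (Fin.castAddEmb m') ∪ Ep.map (Fin.natAddEmb n)) \
                    (slyKeyClass U (some c)).image (fun ε => Fin.castAdd m' ε.2.1),
                  σ c v ∉ T.map (Fin.castAddEmb m') ∪ Em.map (Fin.natAddEmb n)) =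
            Fintype.piFinset fun c : Fin q => univ.filter fun π : Equiv.Perm (Fin (n + m')) =>
              (∀ ε : slyKeyClass U (some c), π (Fin.castAdd m' ε.1.2.1) = Fin.castAdd m' ε.1.2.2) ∧
                ∀ v ∈ (S.map (Fin.castAddEmb m') ∪ Ep.map (Fin.natAddEmb n)) \
                    (slyKeyClass U (some c)).image (fun ε => Fin.castAdd m' ε.2.1),
                  π v ∉ T.map (Fin.castAddEmb m') ∪ Em.map (Fin.natAddEmb n) := by
          ext σ
          simp only [Finset.mem_filter, Finset.mem_univ, true_and, Fintype.mem_piFinset]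
        rw [hpi, Fintype.card_piFinset]
        refine Finset.prod_congr rfl fun c _ => ?_
        rw [Fintype.card_subtype]

/-- **Monotonicity of the avoidance count** `X^{(A)} (M - A)!`: decreasing in the number `A` of
constrained points (for `X ≤ M`). [folklore] -/
theorem descFactorial_mul_factorial_anti {M X A A₀ : ℕ} (hX : X ≤ M) (hA : A₀ ≤ A) (hAM : A ≤ M) :
    X.descFactorial A * (M - A).factorial ≤ X.descFactorial A₀ * (M - A₀).factorial := by
  obtain ⟨d, rfl⟩ : ∃ d, A = A₀ + d := ⟨A - A₀, by omega⟩
  induction d with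
  | zero => simp
  | succ d ih =>
    have h1 := ih (by omega) (by omega)
    calc X.descFactorial (A₀ + (d + 1)) * (M - (A₀ + (d + 1))).factorial
        = (X - (A₀ + d)) * X.descFactorial (A₀ + d) * (M - (A₀ + (d + 1))).factorial := by
          rw [show A₀ + (d + 1) = (A₀ + d) + 1 by ring, Nat.descFactorial_succ]
      _ ≤ (M - (A₀ + d)) * X.descFactorial (A₀ + d) * (M - (A₀ + (d + 1))).factorial := by
          gcongr
      _ = X.descFactorial (A₀ + d) * (M - (A₀ + d)).factorial := by
          have : M - (A₀ + d) = (M - (A₀ + (d + 1))) + 1 := by omega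
          rw [this, Nat.factorial_succ]; ring
      _ ≤ _ := h1

/-- Monotonicity in the base: `X^{(A)} ≤ X'^{(A)}` for `X ≤ X'`. [folklore] -/
theorem descFactorial_mono_left {X X' : ℕ} (h : X ≤ X') (A : ℕ) : X.descFactorial A ≤ X'.descFactorial A := by
  induction A with
  | zero => simp
  | succ A ih =>
    rw [Nat.descFactorial_succ, Nat.descFactorial_succ]
    exact Nat.mul_le_mul (by omega) ih

open scoped Classical in
/-- **Per-colour bound**: with a class of `e` distinct keys prescribed (`x i ↦ y i`) and the avoidance
constraints kept only off the planted points, the number of permutations is at most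
`(|α| - e - (|B| - e))^{(|P| - e)} (|α| - e - (|P| - e))!` (and `0` unless the class is a partial matching).
[cite: Sly2010, Lemma 3.8 (proof)] -/
theorem card_colour_prescribed_le {α : Type*} [Fintype α] [DecidableEq α] {K : Type*} [Fintype K]
    (x y : K → α) (hxy : ∀ i j, x i = x j → y i = y j → i = j) (P B : Finset α) :
    Fintype.card {π : Equiv.Perm α // (∀ i, π (x i) = y i) ∧ ∀ a ∈ P \ univ.image x, π a ∉ B} ≤
      (Fintype.card α - Fintype.card K - (B.card - Fintype.card K)).descFactorial (P.card - Fintype.card K) *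
        (Fintype.card α - Fintype.card K - (P.card - Fintype.card K)).factorial := by
  by_cases hx : Function.Injective x
  · by_cases hy : Function.Injective y
    · rw [card_perm_prescribed_avoid' x y hx hy (P \ univ.image x) B
        (fun i h => (Finset.mem_sdiff.1 h).2 (Finset.mem_image_of_mem _ (Finset.mem_univ _)))]
      have hK : (univ.image x).card = Fintype.card K := by rw [Finset.card_image_of_injective _ hx, Finset.card_univ]
      have hKy : (univ.image y).card = Fintype.card K := by rw [Finset.card_image_of_injective _ hy, Finset.card_univ]
      have hA : P.card - Fintype.card K ≤ (P \ univ.image x).card := by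
        have := Finset.le_card_sdiff (univ.image x) P
        rw [hK] at this; omega
      have hAM : (P \ univ.image x).card ≤ Fintype.card α - Fintype.card K := by
        have h1 : P \ univ.image x ⊆ univ \ univ.image x := Finset.sdiff_subset_sdiff (Finset.subset_univ _) le_rfl
        have h2 := Finset.card_le_card h1
        rw [Finset.card_univ_sdiff, hK] at h2
        exact h2
      have hBy : B.card - Fintype.card K ≤ (B \ univ.image y).card := by
        have := Finset.le_card_sdiff (univ.image y) B
        rw [hKy] at this; omega
      calc (Fintype.card α - Fintype.card K - (B \ univ.image y).card).descFactorial (P \ univ.image x).card *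
            (Fintype.card α - Fintype.card K - (P \ univ.image x).card).factorial
          ≤ (Fintype.card α - Fintype.card K - (B.card - Fintype.card K)).descFactorial (P \ univ.image x).card *
            (Fintype.card α - Fintype.card K - (P \ univ.image x).card).factorial :=
            Nat.mul_le_mul_right _ (descFactorial_mono_left (by omega) _)
        _ ≤ _ := descFactorial_mul_factorial_anti (by omega) hA hAM
    · -- `y` not injective but `x` injective: no permutation works
      have h0 : Fintype.card {π : Equiv.Perm α // (∀ i, π (x i) = y i) ∧ ∀ a ∈ P \ univ.image x, π a ∉ B} = 0 :=
        Fintype.card_eq_zero_iff.2 ⟨fun ⟨π, hπ, _⟩ => hy fun i j h => hx (by apply π.injective; rw [hπ i, hπ j, h])⟩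
      rw [h0]; exact Nat.zero_le _
  · -- `x` not injective: two distinct keys share a point, their values differ, no permutation works
    have h0 : Fintype.card {π : Equiv.Perm α // (∀ i, π (x i) = y i) ∧ ∀ a ∈ P \ univ.image x, π a ∉ B} = 0 :=
      Fintype.card_eq_zero_iff.2 ⟨fun ⟨π, hπ, _⟩ => hx fun i j h => hxy i j h (by rw [← hπ i, ← hπ j, h])⟩
    rw [h0]; exact Nat.zero_le _

end OverlapPlanted

section OverlapPlantedBound

variable {n m' q : ℕ}

open scoped Classical in
/-- **Planting an arbitrary coloured edge set, explicit bound**: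
`#{ω ⊇ U : S ∪ E⁺ ∪ T ∪ E⁻ independent} ≤ Π_c (N-e_c-(b'-e_c))^{(a'-e_c)} (N-e_c-(a'-e_c))! · (n-e_τ-(b-e_τ))^{(a-e_τ)} (n-e_τ-(a-e_τ))!`
with `e_c = |U_c|`, `a' = |S|+|E⁺|`, `b' = |T|+|E⁻|`, `N = n+m'`. [cite: Sly2010, Lemma 3.8 (proof: overlapping configurations)] -/
theorem card_presentU_indep_le_explicit (U : Finset (Option (Fin q) × Fin n × Fin n)) (S T : Finset (Fin n)) (Ep Em : Finset (Fin m')) :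
    Fintype.card {ω : (Fin q → Equiv.Perm (Fin (n + m'))) × Equiv.Perm (Fin n) //
        (∀ ε ∈ U, SlyTriplePresent ω.1 ω.2 ε) ∧ SlyCoreIndep ω.1 ω.2 S T Ep Em} ≤
      (∏ c : Fin q,
        ((n + m' - (slyKeyClass U (some c)).card - (T.card + Em.card - (slyKeyClass U (some c)).card)).descFactorial
            (S.card + Ep.card - (slyKeyClass U (some c)).card) *
          (n + m' - (slyKeyClass U (some c)).card - (S.card + Ep.card - (slyKeyClass U (some c)).card)).factorial)) *
      ((n - (slyKeyClass U none).card - (T.card - (slyKeyClass U none).card)).descFactorial (S.card - (slyKeyClass U none).card) *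
        (n - (slyKeyClass U none).card - (S.card - (slyKeyClass U none).card)).factorial) := by
  refine (card_presentU_indep_le U S T Ep Em).trans ?_
  have hkeys : ∀ (c : Option (Fin q)) (i j : slyKeyClass U c), i.1.2.1 = j.1.2.1 → i.1.2.2 = j.1.2.2 → i = j := by
    intro c i j hp hm
    have hc₁ : i.1.1 = c := (Finset.mem_filter.1 i.2).2
    have hc₂ : j.1.1 = c := (Finset.mem_filter.1 j.2).2
    exact Subtype.ext (Prod.ext (hc₁.trans hc₂.symm) (Prod.ext hp hm))
  have himg : ∀ c : Option (Fin q), ∀ (g : Fin n → Fin (n + m')),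
      (univ : Finset (slyKeyClass U c)).image (fun ε => g ε.1.2.1) = (slyKeyClass U c).image (fun ε => g ε.2.1) := by
    intro c g
    ext v
    simp only [Finset.mem_image, Finset.mem_univ, true_and]
    constructor
    · rintro ⟨ε, rfl⟩; exact ⟨ε.1, ε.2, rfl⟩
    · rintro ⟨ε, hε, rfl⟩; exact ⟨⟨ε, hε⟩, rfl⟩
  have himg' : ∀ c : Option (Fin q),
      (univ : Finset (slyKeyClass U c)).image (fun ε => ε.1.2.1) = (slyKeyClass U c).image (fun ε => ε.2.1) := by
    intro c
    ext v
    simp only [Finset.mem_image, Finset.mem_univ, true_and]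
    constructor
    · rintro ⟨ε, rfl⟩; exact ⟨ε.1, ε.2, rfl⟩
    · rintro ⟨ε, hε, rfl⟩; exact ⟨⟨ε, hε⟩, rfl⟩
  have hP : (S.map (Fin.castAddEmb m') ∪ Ep.map (Fin.natAddEmb n)).card = S.card + Ep.card := card_map_castAddEmb_union_map_natAddEmb S Ep
  have hB : (T.map (Fin.castAddEmb m') ∪ Em.map (Fin.natAddEmb n)).card = T.card + Em.card := card_map_castAddEmb_union_map_natAddEmb T Em
  refine Nat.mul_le_mul (Finset.prod_le_prod' fun c _ => ?_) ?_
  · have h := card_colour_prescribed_le (fun ε : slyKeyClass U (some c) => Fin.castAdd m' ε.1.2.1)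
      (fun ε : slyKeyClass U (some c) => Fin.castAdd m' ε.1.2.2)
      (fun i j hx hy => hkeys _ i j (Fin.castAdd_injective _ _ hx) (Fin.castAdd_injective _ _ hy))
      (S.map (Fin.castAddEmb m') ∪ Ep.map (Fin.natAddEmb n)) (T.map (Fin.castAddEmb m') ∪ Em.map (Fin.natAddEmb n))
    rw [Fintype.card_fin, Fintype.card_coe, hP, hB, himg (some c) (Fin.castAdd m')] at h
    convert h using 2
    rfl
  · have h := card_colour_prescribed_le (fun ε : slyKeyClass U none => ε.1.2.1) (fun ε : slyKeyClass U none => ε.1.2.2)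
      (fun i j hx hy => hkeys _ i j hx hy) S T
    rw [Fintype.card_fin, Fintype.card_coe, himg' none] at h
    convert h using 2

end OverlapPlantedBound

section OverlapFamilySlice

variable {n m' q k : ℕ} {mv : Fin k → ℕ}

open scoped Classical in
/-- **Per-family overlap bound, combinatorial half**: summed over the slice `|S| = a`, `|T| = b`, the
planted-with-independence counts of ANY family are at most `C(n,a) C(n,b)` times the product bound of
`card_presentU_indep_le_explicit` for its edge union `U(F)` (which depends on `(S,T)` only through `(a,b)`).
[cite: Sly2010, Lemma 3.8 (proof: overlapping configurations)] -/
theorem sum_slice_present_indep_le (F : (i : Fin k) → Fin (mv i) → SlyWCycle n q ((i : ℕ) + 1)) (a b : ℕ)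
    (Ep Em : Finset (Fin m')) :
    ∑ S ∈ (univ : Finset (Fin n)).powersetCard a, ∑ T ∈ (univ : Finset (Fin n)).powersetCard b,
        Fintype.card {ω : (Fin q → Equiv.Perm (Fin (n + m'))) × Equiv.Perm (Fin n) //
          (∀ i a', (F i a').Present ω.1 ω.2) ∧ SlyCoreIndep ω.1 ω.2 S T Ep Em} ≤
      n.choose a * n.choose b *
        ((∏ c : Fin q,
          ((n + m' - (slyKeyClass (slyFamUnionES F) (some c)).card -
                (b + Em.card - (slyKeyClass (slyFamUnionES F) (some c)).card)).descFactorial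
              (a + Ep.card - (slyKeyClass (slyFamUnionES F) (some c)).card) *
            (n + m' - (slyKeyClass (slyFamUnionES F) (some c)).card -
                (a + Ep.card - (slyKeyClass (slyFamUnionES F) (some c)).card)).factorial)) *
        ((n - (slyKeyClass (slyFamUnionES F) none).card - (b - (slyKeyClass (slyFamUnionES F) none).card)).descFactorial
            (a - (slyKeyClass (slyFamUnionES F) none).card) *
          (n - (slyKeyClass (slyFamUnionES F) none).card - (a - (slyKeyClass (slyFamUnionES F) none).card)).factorial)) := by
  have hterm : ∀ S ∈ (univ : Finset (Fin n)).powersetCard a, ∀ T ∈ (univ : Finset (Fin n)).powersetCard b,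
      Fintype.card {ω : (Fin q → Equiv.Perm (Fin (n + m'))) × Equiv.Perm (Fin n) //
          (∀ i a', (F i a').Present ω.1 ω.2) ∧ SlyCoreIndep ω.1 ω.2 S T Ep Em} ≤
        (∏ c : Fin q,
          ((n + m' - (slyKeyClass (slyFamUnionES F) (some c)).card -
                (b + Em.card - (slyKeyClass (slyFamUnionES F) (some c)).card)).descFactorial
              (a + Ep.card - (slyKeyClass (slyFamUnionES F) (some c)).card) *
            (n + m' - (slyKeyClass (slyFamUnionES F) (some c)).card -
                (a + Ep.card - (slyKeyClass (slyFamUnionES F) (some c)).card)).factorial)) *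
        ((n - (slyKeyClass (slyFamUnionES F) none).card - (b - (slyKeyClass (slyFamUnionES F) none).card)).descFactorial
            (a - (slyKeyClass (slyFamUnionES F) none).card) *
          (n - (slyKeyClass (slyFamUnionES F) none).card - (a - (slyKeyClass (slyFamUnionES F) none).card)).factorial) := by
    intro S hS T hT
    have hSa : S.card = a := (Finset.mem_powersetCard.1 hS).2
    have hTb : T.card = b := (Finset.mem_powersetCard.1 hT).2
    have h := card_presentU_indep_le_explicit (slyFamUnionES F) S T Ep Em
    rw [hSa, hTb] at h
    refine le_trans (le_of_eq ?_) h
    apply Fintype.card_congr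
    exact Equiv.subtypeEquivRight fun ω => by rw [present_family_iff_union]
  calc ∑ S ∈ (univ : Finset (Fin n)).powersetCard a, ∑ T ∈ (univ : Finset (Fin n)).powersetCard b,
        Fintype.card {ω : (Fin q → Equiv.Perm (Fin (n + m'))) × Equiv.Perm (Fin n) //
          (∀ i a', (F i a').Present ω.1 ω.2) ∧ SlyCoreIndep ω.1 ω.2 S T Ep Em}
      ≤ ∑ S ∈ (univ : Finset (Fin n)).powersetCard a, ∑ T ∈ (univ : Finset (Fin n)).powersetCard b,
        (∏ c : Fin q,
          ((n + m' - (slyKeyClass (slyFamUnionES F) (some c)).card -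
                (b + Em.card - (slyKeyClass (slyFamUnionES F) (some c)).card)).descFactorial
              (a + Ep.card - (slyKeyClass (slyFamUnionES F) (some c)).card) *
            (n + m' - (slyKeyClass (slyFamUnionES F) (some c)).card -
                (a + Ep.card - (slyKeyClass (slyFamUnionES F) (some c)).card)).factorial)) *
        ((n - (slyKeyClass (slyFamUnionES F) none).card - (b - (slyKeyClass (slyFamUnionES F) none).card)).descFactorial
            (a - (slyKeyClass (slyFamUnionES F) none).card) *
          (n - (slyKeyClass (slyFamUnionES F) none).card - (a - (slyKeyClass (slyFamUnionES F) none).card)).factorial) :=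
        Finset.sum_le_sum fun S hS => Finset.sum_le_sum fun T hT => hterm S hS T hT
    _ = _ := by rw [Finset.sum_const, Finset.sum_const, smul_eq_mul, smul_eq_mul, Finset.card_powersetCard, Finset.card_powersetCard,
          Finset.card_univ, Fintype.card_fin]; ring

end OverlapFamilySlice

end Literature.Computability.Complexity
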